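import Literature.AlgebraicGeometry.Villaflor2022.SecondGapTangentBound
import HarnessLib

/-!
# Villaflor's second gap at the Fermat point — Theorem 1.3, the EQUALITY clause (`n ≥ 4`)

R. Villaflor Loyola, *Small codimension components of the Hodge locus containing the Fermat variety*,
Commun. Contemp. Math. 24 (2022) 2150053 = arXiv:2001.01019 [Villaflorloyola2021], Theorem 1.3, last part
(verbatim, chunk p0005 of `paper:arxiv-2001.01019`):

> Furthermore, if the equality in (desteo2) is attained and `n ≥ 4`, then there exists a complete intersection
> `Z ⊆ ℙ^{n+1}` of type `(1,1,…,1,2)` such that `I(Z) ⊆ J^{F,λ}`.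

(§7, p0014: in the equality case the leading-term ideal of `J^{F,λ}` is one of (7.2)–(7.4), hence
`J^{F,λ}_k = ⟨L_0, L_2, …, L_{n−2}, C_n, D_{n+1}⟩_k` for `k ≤ d − 2` with `LT(L_i) = x_i`, `LT(C_n) = x_n²` (7.5), and
`Z := {L_0 = ⋯ = L_{n−2} = C_n = 0}`.)

This file proves the clause at the level of the Artinian Gorenstein ideal `J^{F,λ} = Ann ℓ` of a functional `ℓ ≠ 0`
concentrated in degree `σ = (k+1)(d−2)` and killing `J^F = (x_i^{d−1})` (`k = n/2 ≥ 2`, `d ≥ 4`), continuing the tree's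
`Villaflor2022/SecondGapTangentBound` (the inequality (desteo2)):

* `hilbert_one_two_of_hilbert_eq_secondGap` — if `HF_{Ann ℓ}(d) = ciHilbert(2, d−2, (d−1)^k)(d)` (the `(1,…,1,2)` value)
  then `HF_{Ann ℓ}(1) = k + 2` and `HF_{Ann ℓ}(2) ≤ C(k+3, 2) − 1`;
* `exists_quadric_not_mem_span_linearForms_of_hilbert_eq_secondGap` — for `m = n + 2 = 2k + 2` variables:
  `dim (Ann ℓ)_1 = n/2` and there is a quadric `C ∈ (Ann ℓ)_2` NOT in the ideal generated by `(Ann ℓ)_1`; i.e. with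
  `L_0, …, L_{n/2−1}` a basis of `(Ann ℓ)_1`, `Z := V(L_0, …, L_{n/2−1}, C) ⊆ ℙ^{n+1}` is a complete intersection of type
  `(1,…,1,2)` with `I(Z) = (L_0, …, L_{n/2−1}, C) ⊆ Ann ℓ = J^{F,λ}` — the printed conclusion;
* the period-matrix / census forms: `exists_quadric_of_rank_periodMatrix_eq_secondGap` (`m` variables),
  `exists_quadric_of_rank_periodMatrix_eq_ciLocusCodim` (Fermat `n`-fold: `rank [p_{i+j}] = ciLocusCodim (1^{n/2},2) d`
  ⇒ `dim (J^{F,δ})_1 = n/2` and a quadric of `J^{F,δ}` outside `((J^{F,δ})_1)`), the rows `(4,4)` rank `8`,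
  `(4,5)` rank `19`, `(6,4)` rank `26`, `(8,4)` rank `61`, and the form for combinations of linear cycles
  (`exists_quadric_comb_of_rank_periodMatrix_eq_ciLocusCodim`, tree `MovasatiVillaflor2018.combPeriod`).

FORMALISATION REMARK. The printed proof determines the whole initial ideal ("by a similar argument as in the equality of
(igualdad1)") in the three cases of the proof of (desteo2). We follow the same case distinction (socle standard monomial
`x^α` concentrated or not) and the same mechanism (equality forces the degree-`d` standard monomials to be exactly the
counted ones; the initial ideal is then generated in degrees `≤ d`, so the standard monomials of every degree `u ≥ d` are
divisors of `x^α` (Case 1) or of `x^α` or `x^{α'}` (Case 2); Gorenstein duality `HF(e) = HF(σ − e)` transports this to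
`e = 1, 2`), but read off only `HF(1)` and `HF(2)`, which is all the conclusion needs: `HF(1) = k+2` gives exactly
`n/2` linear forms, and `HF(2) < C(k+3,2)` gives a quadric of `Ann ℓ` whose leading monomial involves standard variables
only, hence (reduced echelon forms `x_p − r_p` of the linear forms, substitution `x_p ↦ r_p`) not in the ideal of the
linear forms. The strictness inputs are Proposition 3.3's strict shift (tree `Movasati2017.card_divSet_shift_lt`):
for `k ≥ 2` a non-concentrated shape attaining the second bound has support `k+2` and an exponent `1`
(`card_support_eq_and_exists_eq_one_of_card_divSet_eq`), and a shape of degree `σ−2` with support `≥ k+2` exceeds the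
greedy count (`ciHilbert_sub_two_lt_card_divSet_of_support`) — this is where `n ≥ 4` enters (for `n = 2` both fail:
`(2,2,2)` at `d = 5`, cf. the module docstring of `SecondGapTangentBound`). That degrees `1` and `2` of the Hilbert
function are what the characterisation needs is also the author's reading (§8, p0015): "If we show this continuity of
the Hilbert function of `R^{F,λ}` at least for degrees 1 and 2, we would be able to characterize the components attaining
the equality in (desteo2) as the one corresponding to a complete intersection of type `(1,…,1,2)`.".

HONEST FRAMING (cell pub-hlocus): certified instances and evidence bearing on the general Hodge conjecture; no claim.

## References
* R. Villaflor Loyola, Commun. Contemp. Math. 24 (2022) 2150053 = arXiv:2001.01019, Thm. 1.3, Prop. 3.3, §7 (7.2)–(7.5).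
  [Villaflorloyola2021]
* H. Movasati, Asian J. Math. 21 (2017) 463–482 = arXiv:1411.1766, §3.5 Prop. 8. [Movasati2017GMCD]
* H. Movasati, arXiv:1602.06607, Def. 1, Thm. 6 (the matrix `[p_{i+j}]`). [Movasati2016Periods]
-/

noncomputable section

namespace Literature.AlgebraicGeometry.Villaflor2022

open Finset Literature.AlgebraicGeometry.Movasati2017
open Literature.AlgebraicGeometry.Kloosterman2023 (ciHilbert ciHilbert_nil ciHilbert_cons ciHilbert_one_cons
  ciHilbert_zero_cons ciLocusCodim)

/-! ## Combinatorics of divisor counts near the top degree, and the two strictness lemmas -/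

section Combinatorics

variable {τ : Type*} [Fintype τ] [DecidableEq τ]

/-- `Σ` over `List.range` is the `Finset.range` sum. [folklore] -/
private theorem sum_map_range₂ (f : ℕ → ℕ) (n : ℕ) :
    ((List.range n).map f).sum = ∑ a ∈ Finset.range n, f a := by
  induction n with
  | zero => simp
  | succ n ih => rw [List.range_succ, List.map_append, List.sum_append, ih, Finset.sum_range_succ]; simp

/-- Bookkeeping: the total of a function changed at one place. [folklore] -/
private theorem sum_update_add₂ (g : τ → ℕ) (i : τ) (a : ℕ) :
    ∑ e, Function.update g i a e + g i = ∑ e, g e + a := by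
  have h1 := Finset.sum_update_of_mem (Finset.mem_univ i) g a
  have h2 := Finset.sum_eq_add_sum_sdiff_singleton_of_mem (Finset.mem_univ i) g
  omega

/-- The peeling sum truncates at the column degree: `Σ_{j < a} [j ≤ M] h(M − j) = Σ_{j ≤ M} h(M − j)` for `M < a`.
[cite: Kloosterman2023, §2 eq. (1)] -/
private theorem sum_range_ite_le (H : ℕ → ℕ) {a M : ℕ} (hM : M < a) :
    ∑ j ∈ Finset.range a, (if j ≤ M then H (M - j) else 0) = ∑ j ∈ Finset.range (M + 1), H (M - j) := by
  have hsub : Finset.range (M + 1) ⊆ Finset.range a := Finset.range_subset_range.mpr (by omega)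
  rw [← Finset.sum_subset hsub (fun j hj hj' => ?_)]
  · exact Finset.sum_congr rfl fun j hj => if_pos (by have := Finset.mem_range.mp hj; omega)
  · rw [Finset.mem_range] at hj'
    exact if_neg (by omega)

/-- `ciHilbert((c+1)^s)(1) = s` (`c ≥ 1`): the `s` variables. [cite: Kloosterman2023, §2 eq. (1)] -/
theorem ciHilbert_replicate_one {c : ℕ} (hc : 1 ≤ c) (s : ℕ) : ciHilbert (List.replicate s (c + 1)) 1 = s := by
  induction s with
  | zero => simp [ciHilbert_nil]
  | succ s ih =>
    rw [List.replicate_succ, ciHilbert_cons, sum_map_range₂, sum_range_ite_le _ (by omega : 1 < c + 1)]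
    simp only [Finset.sum_range_succ, Finset.sum_range_zero, Nat.sub_zero, Nat.sub_self, zero_add]
    rw [ih, ciHilbert_at_zero (fun x hx => by rw [List.eq_of_mem_replicate hx]; omega)]

/-- `ciHilbert((c+1)^s)(2) = C(s+1, 2)` (`c ≥ 2`): all quadratic monomials in `s` variables (the exponent cap `c ≥ 2`
does not bite in degree `2`). [cite: Kloosterman2023, §2 eq. (1)] -/
theorem ciHilbert_replicate_two {c : ℕ} (hc : 2 ≤ c) (s : ℕ) :
    ciHilbert (List.replicate s (c + 1)) 2 = (s + 1).choose 2 := by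
  induction s with
  | zero => simp [ciHilbert_nil]
  | succ s ih =>
    rw [List.replicate_succ, ciHilbert_cons, sum_map_range₂, sum_range_ite_le _ (by omega : 2 < c + 1)]
    have hsum3 : ∑ j ∈ Finset.range (2 + 1), ciHilbert (List.replicate s (c + 1)) (2 - j) =
        ciHilbert (List.replicate s (c + 1)) 2 + ciHilbert (List.replicate s (c + 1)) 1 +
          ciHilbert (List.replicate s (c + 1)) 0 := by
      simp [Finset.sum_range_succ]
    rw [hsum3, ih, ciHilbert_replicate_one (by omega) s,
      ciHilbert_at_zero (fun x hx => by rw [List.eq_of_mem_replicate hx]; omega)]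
    have h : (s + 1 + 1).choose 2 = (s + 1).choose 1 + (s + 1).choose 2 := Nat.choose_succ_succ (s + 1) 1
    rw [Nat.choose_one_right] at h
    omega

/-- The only divisor of `x^κ` of degree `|κ|` is `x^κ` itself. [cite: Villaflorloyola2021, Proposition 3.3] -/
theorem divSet_sum_self (κ : τ → ℕ) : divSet κ (∑ e, κ e) = {κ} := by
  ext j
  rw [mem_divSet, Finset.mem_singleton]
  constructor
  · rintro ⟨hle, hsum⟩
    funext e
    by_contra hne
    have hlt : j e < κ e := lt_of_le_of_ne (hle e) hne
    have h : ∑ x, j x < ∑ x, κ x := Finset.sum_lt_sum (fun x _ => hle x) ⟨e, Finset.mem_univ _, hlt⟩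
    omega
  · rintro rfl
    exact ⟨fun e => le_rfl, rfl⟩

/-- The divisors of `x^κ` of degree `|κ| − 1` are the `x^κ / x_e`, `e ∈ supp κ`: there are `#supp κ` of them.
[cite: Villaflorloyola2021, Proposition 3.3] -/
theorem card_divSet_sum_sub_one (κ : τ → ℕ) (h : 1 ≤ ∑ e, κ e) :
    (divSet κ (∑ e, κ e - 1)).card = (Finset.univ.filter fun e => 0 < κ e).card := by
  have himg : divSet κ (∑ e, κ e - 1) =
      (Finset.univ.filter fun e => 0 < κ e).image fun e => Function.update κ e (κ e - 1) := by
    ext j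
    rw [mem_divSet, Finset.mem_image]
    constructor
    · rintro ⟨hle, hsum⟩
      have hδ : ∑ x, (κ x - j x) = 1 := by
        rw [Finset.sum_tsub_distrib Finset.univ (fun x _ => hle x)]; omega
      obtain ⟨e₀, he₀⟩ : ∃ e, 0 < κ e - j e := by
        by_contra hno
        push Not at hno
        have : ∑ x, (κ x - j x) = 0 := Finset.sum_eq_zero fun x _ => Nat.le_zero.mp (hno x)
        omega
      have hsplit := Finset.sum_eq_add_sum_sdiff_singleton_of_mem (Finset.mem_univ e₀) (fun x => κ x - j x)
      have hzero : ∑ x ∈ Finset.univ \ {e₀}, (κ x - j x) = 0 := by omega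
      have hrest : ∀ x ∈ Finset.univ \ {e₀}, κ x - j x = 0 := Finset.sum_eq_zero_iff.mp hzero
      refine ⟨e₀, Finset.mem_filter.mpr ⟨Finset.mem_univ _, by omega⟩, ?_⟩
      funext x
      by_cases hx : x = e₀
      · rw [hx, Function.update_self]; omega
      · rw [Function.update_of_ne hx]
        have := hrest x (by simp [hx]); have := hle x; omega
    · rintro ⟨e, he, rfl⟩
      have he' : 0 < κ e := (Finset.mem_filter.mp he).2
      refine ⟨fun x => ?_, ?_⟩
      · by_cases hx : x = e
        · rw [hx, Function.update_self]; omega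
        · rw [Function.update_of_ne hx]
      · have := sum_update_add₂ κ e (κ e - 1); omega
  rw [himg, Finset.card_image_of_injOn]
  intro e he e' _ hee'
  by_contra hne
  have h1 := congr_fun hee' e
  dsimp only at h1
  rw [Function.update_self, Function.update_of_ne hne] at h1
  have he0 : 0 < κ e := (Finset.mem_filter.mp (Finset.mem_coe.mp he)).2
  omega

/-- **Symmetry of the divisor count**: `x^β ↦ x^κ / x^β` is a bijection `A_κ(M) ≅ A_κ(|κ| − M)`.
[cite: Villaflorloyola2021, Proposition 3.3] -/
theorem card_divSet_symm (κ : τ → ℕ) {M : ℕ} (hM : M ≤ ∑ e, κ e) :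
    (divSet κ M).card = (divSet κ (∑ e, κ e - M)).card := by
  refine Finset.card_nbij' (fun j e => κ e - j e) (fun j e => κ e - j e) (fun j hj => ?_) (fun j hj => ?_)
    (fun j hj => ?_) (fun j hj => ?_)
  · obtain ⟨hle, hsum⟩ := mem_divSet.mp (Finset.mem_coe.mp hj)
    rw [Finset.mem_coe, mem_divSet]
    refine ⟨fun e => Nat.sub_le _ _, ?_⟩
    rw [Finset.sum_tsub_distrib Finset.univ (fun x _ => hle x), hsum]
  · obtain ⟨hle, hsum⟩ := mem_divSet.mp (Finset.mem_coe.mp hj)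
    rw [Finset.mem_coe, mem_divSet]
    refine ⟨fun e => Nat.sub_le _ _, ?_⟩
    rw [Finset.sum_tsub_distrib Finset.univ (fun x _ => hle x), hsum]
    omega
  · obtain ⟨hle, -⟩ := mem_divSet.mp (Finset.mem_coe.mp hj)
    funext e; dsimp only; have := hle e; omega
  · obtain ⟨hle, -⟩ := mem_divSet.mp (Finset.mem_coe.mp hj)
    funext e; dsimp only; have := hle e; omega

/-- In degree `2`, a shape with an exponent `κ_{e₀} = 1` misses the square `x_{e₀}²`: `#A_κ(2) ≤ C(#supp κ + 1, 2) − 1`.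
[cite: Villaflorloyola2021, Proposition 3.3, §7] -/
theorem card_divSet_two_lt {κ : τ → ℕ} {e₀ : τ} (he₀ : κ e₀ = 1) :
    (divSet κ 2).card + 1 ≤ ((Finset.univ.filter fun e => 0 < κ e).card + 1).choose 2 := by
  set S : Finset τ := Finset.univ.filter fun e => 0 < κ e with hS
  set μ₀ : τ → ℕ := fun e => if e = e₀ then 2 else 0 with hμ₀
  have hμ₀sum : ∑ e, μ₀ e = 2 := by rw [hμ₀, Finset.sum_ite_eq' Finset.univ e₀]; simp
  have hmem : μ₀ ∈ divSet (fun e => if e ∈ S then 2 else 0) 2 := by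
    rw [mem_divSet]
    refine ⟨fun e => ?_, hμ₀sum⟩
    by_cases he : e = e₀
    · rw [he]; simp only [hμ₀, if_true]; rw [if_pos (by simp [hS, he₀])]
    · simp only [hμ₀, if_neg he]; exact Nat.zero_le _
  have hsub : divSet κ 2 ⊆ (divSet (fun e => if e ∈ S then 2 else 0) 2).erase μ₀ := by
    intro j hj
    obtain ⟨hle, hsum⟩ := mem_divSet.mp hj
    rw [Finset.mem_erase, mem_divSet]
    refine ⟨?_, fun e => ?_, hsum⟩
    · intro hj2
      have h1 := congr_fun hj2 e₀
      simp only [hμ₀, if_true] at h1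
      have := hle e₀; omega
    · have hje : j e ≤ 2 := by
        have := Finset.single_le_sum (fun x _ => Nat.zero_le (j x)) (Finset.mem_univ e); omega
      split_ifs with he
      · exact hje
      · have : ¬ 0 < κ e := by simpa [hS] using he
        have := hle e; omega
  have hcard := Finset.card_le_card hsub
  rw [Finset.card_erase_of_mem hmem, card_divSet_indicator, ciHilbert_replicate_two le_rfl] at hcard
  have hpos : 1 ≤ (S.card + 1).choose 2 := by
    rw [← ciHilbert_replicate_two (le_rfl : 2 ≤ 2), ← card_divSet_indicator]
    exact Finset.card_pos.mpr ⟨μ₀, hmem⟩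
  omega

/-- A vector squeezed between `g ≤ γ` of any prescribed total between `|g|` and `|γ|` exists. [folklore] -/
private theorem exists_between_sum_eq (g γ : τ → ℕ) (hg : ∀ e, g e ≤ γ e) {M : ℕ} (h1 : ∑ e, g e ≤ M)
    (h2 : M ≤ ∑ e, γ e) :
    ∃ γ' : τ → ℕ, (∀ e, g e ≤ γ' e) ∧ (∀ e, γ' e ≤ γ e) ∧ ∑ e, γ' e = M := by
  suffices h : ∀ (n : ℕ) (γ : τ → ℕ), (∀ e, g e ≤ γ e) → ∑ e, γ e = M + n →
      ∃ γ' : τ → ℕ, (∀ e, g e ≤ γ' e) ∧ (∀ e, γ' e ≤ γ e) ∧ ∑ e, γ' e = M from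
    h (∑ e, γ e - M) γ hg (by omega)
  intro n
  induction n with
  | zero => intro γ hg hsum; exact ⟨γ, hg, fun e => le_rfl, by omega⟩
  | succ n ih =>
    intro γ hg hsum
    obtain ⟨e₀, he₀⟩ : ∃ e, g e < γ e := by
      by_contra hno
      push Not at hno
      have : ∑ e, γ e ≤ ∑ e, g e := Finset.sum_le_sum fun e _ => hno e
      omega
    have hg' : ∀ e, g e ≤ Function.update γ e₀ (γ e₀ - 1) e := by
      intro e
      by_cases he : e = e₀
      · rw [he, Function.update_self]; omega
      · rw [Function.update_of_ne he]; exact hg e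
    have hsum' : ∑ e, Function.update γ e₀ (γ e₀ - 1) e = M + n := by
      have := sum_update_add₂ γ e₀ (γ e₀ - 1); omega
    obtain ⟨γ', h1', h2', h3'⟩ := ih _ hg' hsum'
    refine ⟨γ', h1', fun e => le_trans (h2' e) ?_, h3'⟩
    by_cases he : e = e₀
    · rw [he, Function.update_self]; omega
    · rw [Function.update_of_ne he]

omit [DecidableEq τ] in
/-- A box vector `κ ∈ [0,c]^τ` of total `(k+1)c` with an exponent strictly between `0` and `c` has at least
`k + 2` non-zero exponents. [cite: Villaflorloyola2021, Proposition 3.3] -/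
theorem card_support_ge_of_mid {c k : ℕ} {κ : τ → ℕ} (hle : ∀ e, κ e ≤ c)
    (hsum : ∑ e, κ e = (k + 1) * c) (hmid : ∃ e, 0 < κ e ∧ κ e < c) :
    k + 2 ≤ (Finset.univ.filter fun e => 0 < κ e).card := by
  set S : Finset τ := Finset.univ.filter fun e => 0 < κ e with hS
  have hS' : ∑ e, κ e = ∑ e ∈ S, κ e := by
    rw [hS, Finset.sum_filter]
    refine Finset.sum_congr rfl fun e _ => ?_
    split_ifs with h
    · rfl
    · have := hle e; omega
  obtain ⟨e₁, he₁, he₁'⟩ := hmid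
  have hlt : ∑ e ∈ S, κ e < ∑ e ∈ S, c :=
    Finset.sum_lt_sum (fun e _ => hle e) ⟨e₁, by simp [hS, he₁], he₁'⟩
  rw [Finset.sum_const, smul_eq_mul, ← hS', hsum] at hlt
  have := Nat.lt_of_mul_lt_mul_right hlt
  omega

omit [DecidableEq τ] in
/-- Conversely, a box vector of total `(k+1)c` with at least `k + 2` non-zero exponents is not concentrated.
[cite: Villaflorloyola2021, Proposition 3.3] -/
theorem exists_mid_of_card_support {c k : ℕ} {κ : τ → ℕ} (hle : ∀ e, κ e ≤ c)
    (hsum : ∑ e, κ e = (k + 1) * c) (hsupp : k + 2 ≤ (Finset.univ.filter fun e => 0 < κ e).card) :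
    ∃ e, 0 < κ e ∧ κ e < c := by
  by_contra hno
  push Not at hno
  set S : Finset τ := Finset.univ.filter fun e => 0 < κ e with hS
  have hS' : ∑ e, κ e = ∑ e ∈ S, c := by
    rw [hS, Finset.sum_filter]
    refine Finset.sum_congr rfl fun e _ => ?_
    split_ifs with h
    · exact le_antisymm (hle e) (hno e h)
    · omega
  rw [Finset.sum_const, smul_eq_mul, hsum] at hS'
  rcases Nat.eq_zero_or_pos c with hc | hc
  · subst hc
    have h0 : S = ∅ := by
      rw [hS, Finset.filter_eq_empty_iff]
      intro e _ h; have := hle e; omega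
    rw [h0, Finset.card_empty] at hsupp
    omega
  · have := Nat.eq_of_mul_eq_mul_right hc hS'
    omega

/-- **Strictness for Case 1** (`k ≥ 2`, `c = d − 2 ≥ 2`): a NON-concentrated box vector of total `(k+1)c` whose
degree-`(c+2)` divisor count ATTAINS the second bound `ciHilbert(2, c, (c+1)^k)(c+2)` has exactly `k + 2` non-zero
exponents, one of which equals `1` (Villaflor Prop. 3.3: "with equality if and only if up to some relabeling of the
coordinates `α = (0,…,0,1,d−3,d−2,…,d−2)`"; only these two consequences are extracted, and `k ≥ 2` is needed:
`(2,2,2)` at `(k,c) = (1,3)` also attains the bound). Otherwise one strict shift (tree `card_divSet_shift_lt`) lands on a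
non-concentrated shape, which is still above the bound. [cite: Villaflorloyola2021, Proposition 3.3, §7 Case 1]
[cite: Movasati2017GMCD, §3.5 Proposition 8] -/
theorem card_support_eq_and_exists_eq_one_of_card_divSet_eq {c k : ℕ} (hk : 2 ≤ k) {κ : τ → ℕ}
    (hle : ∀ e, κ e ≤ c) (hsum : ∑ e, κ e = (k + 1) * c) (hmid : ∃ e, 0 < κ e ∧ κ e < c)
    (heq : (divSet κ (c + 2)).card = ciHilbert (2 :: c :: List.replicate k (c + 1)) (c + 2)) :
    (Finset.univ.filter fun e => 0 < κ e).card = k + 2 ∧ ∃ e, κ e = 1 := by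
  classical
  by_contra hnot
  have hsupp := card_support_ge_of_mid hle hsum hmid
  obtain ⟨i, j, hij, hi, hij', hj⟩ := exists_shift_pair hle hsum hmid
  have hle' : ∀ e, shift κ i j e ≤ c := fun e => by
    by_cases hei : e = i
    · rw [hei, shift_apply_left κ hij]; have := hle i; omega
    by_cases hej : e = j
    · rw [hej, shift_apply_right]; omega
    rw [shift_apply_of_ne κ hei hej]; exact hle e
  have hsum' : ∑ e, shift κ i j e = (k + 1) * c := by rw [sum_shift κ hij hi, hsum]
  -- the shifted shape still has `≥ k + 2` non-zero exponents
  have hsupp' : k + 2 ≤ (Finset.univ.filter fun e => 0 < shift κ i j e).card := by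
    have hsub : (Finset.univ.filter fun e => 0 < κ e).erase i ⊆ Finset.univ.filter fun e => 0 < shift κ i j e := by
      intro e he
      obtain ⟨hei, he'⟩ := Finset.mem_erase.mp he
      have he'' : 0 < κ e := (Finset.mem_filter.mp he').2
      rw [Finset.mem_filter]
      refine ⟨Finset.mem_univ _, ?_⟩
      by_cases hej : e = j
      · rw [hej, shift_apply_right]; omega
      · rw [shift_apply_of_ne κ hei hej]; exact he''
    by_cases hi1 : κ i = 1
    · -- then `#supp κ ≠ k + 2`, so `#supp κ ≥ k + 3`
      have hne : (Finset.univ.filter fun e => 0 < κ e).card ≠ k + 2 := fun h => hnot ⟨h, i, hi1⟩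
      have hiS : i ∈ Finset.univ.filter (fun e => 0 < κ e) := Finset.mem_filter.mpr ⟨Finset.mem_univ _, hi⟩
      have h1 := Finset.card_le_card hsub
      rw [Finset.card_erase_of_mem hiS] at h1
      omega
    · -- `κ_i ≥ 2`: the support does not change
      have hsub' : (Finset.univ.filter fun e => 0 < κ e) ⊆ Finset.univ.filter fun e => 0 < shift κ i j e := by
        intro e he
        by_cases hei : e = i
        · rw [Finset.mem_filter]; refine ⟨Finset.mem_univ _, ?_⟩
          rw [hei, shift_apply_left κ hij]; omega
        · exact hsub (Finset.mem_erase.mpr ⟨hei, he⟩)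
      exact le_trans hsupp (Finset.card_le_card hsub')
  have hmid' := exists_mid_of_card_support hle' hsum' hsupp'
  have h1 := ciHilbert_preFinal_le_card_divSet hle' hsum' hmid' (c + 2)
  have h3c : 3 * c ≤ (k + 1) * c := Nat.mul_le_mul_right c (by omega)
  have h2 := card_divSet_shift_lt κ hij hi hij' (M := c + 2) (by omega) (by rw [hsum]; omega)
  omega

/-- **Strictness for Case 2** (`k ≥ 2`, `c = d − 2 ≥ 2`): a box vector `κ ∈ [0,c]^τ` of total `(k+1)c − 2` with at
least `k + 2` non-zero exponents has STRICTLY more than `ciHilbert(c−1, (c+1)^k)(c+1)` divisors of degree `c + 1`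
(the greedy shape `((c)^k, c−2)` realising that count has support `≤ k+1`; one strict shift, tree
`card_divSet_shift_lt`, then `ciHilbert_sub_two_le_card_divSet`). This is the step "for `n ≥ 4` the inequality (desteo2)
is strict in Case 2.2". [cite: Villaflorloyola2021, Proposition 3.3, §7 Case 2] [cite: Movasati2017GMCD, §3.5 Proposition 8] -/
theorem ciHilbert_sub_two_lt_card_divSet_of_support {c k : ℕ} (hc : 2 ≤ c) (hk : 2 ≤ k) {κ : τ → ℕ}
    (hle : ∀ e, κ e ≤ c) (hsum : ∑ e, κ e + 2 = (k + 1) * c)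
    (hsupp : k + 2 ≤ (Finset.univ.filter fun e => 0 < κ e).card) :
    ciHilbert ((c - 1) :: List.replicate k (c + 1)) (c + 1) < (divSet κ (c + 1)).card := by
  classical
  -- full and intermediate exponents
  set Fu : Finset τ := Finset.univ.filter fun e => κ e = c with hFu
  set A : Finset τ := Finset.univ.filter fun e => 0 < κ e ∧ κ e < c with hA
  have hFu_le : Fu.card * c ≤ ∑ e, κ e := by
    calc Fu.card * c = ∑ e ∈ Fu, c := by rw [Finset.sum_const, smul_eq_mul]
      _ = ∑ e ∈ Fu, κ e := Finset.sum_congr rfl fun e he => by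
          have : κ e = c := (Finset.mem_filter.mp he).2
          rw [this]
      _ ≤ ∑ e, κ e := Finset.sum_le_sum_of_subset (Finset.subset_univ Fu)
  have hFu_card : Fu.card ≤ k := by
    have h1 : Fu.card * c < (k + 1) * c := by omega
    have := Nat.lt_of_mul_lt_mul_right h1
    omega
  have hS_sub : (Finset.univ.filter fun e => 0 < κ e) ⊆ Fu ∪ A := by
    intro e he
    have he' : 0 < κ e := (Finset.mem_filter.mp he).2
    rw [Finset.mem_union, hFu, hA, Finset.mem_filter, Finset.mem_filter]
    have := hle e
    by_cases h : κ e = c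
    · exact Or.inl ⟨Finset.mem_univ _, h⟩
    · exact Or.inr ⟨Finset.mem_univ _, he', by omega⟩
  have hA_card : 2 ≤ A.card := by
    have := le_trans (Finset.card_le_card hS_sub) (Finset.card_union_le Fu A)
    omega
  -- a shift pair inside `A`: `i` of least exponent, `j ≠ i`
  have hAne : A.Nonempty := Finset.card_pos.mp (by omega)
  obtain ⟨i, hiA, himin⟩ := Finset.exists_min_image A κ hAne
  have hAi : 1 ≤ (A.erase i).card := by rw [Finset.card_erase_of_mem hiA]; omega
  obtain ⟨j, hj⟩ := Finset.card_pos.mp (by omega : 0 < (A.erase i).card)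
  obtain ⟨hji, hjA⟩ := Finset.mem_erase.mp hj
  have hij : i ≠ j := fun h => hji h.symm
  obtain ⟨hi, hic⟩ : 0 < κ i ∧ κ i < c := (Finset.mem_filter.mp hiA).2
  obtain ⟨-, hjc⟩ : 0 < κ j ∧ κ j < c := (Finset.mem_filter.mp hjA).2
  have hij' : κ i ≤ κ j := himin j hjA
  have hle' : ∀ e, shift κ i j e ≤ c := fun e => by
    by_cases hei : e = i
    · rw [hei, shift_apply_left κ hij]; omega
    by_cases hej : e = j
    · rw [hej, shift_apply_right]; omega
    rw [shift_apply_of_ne κ hei hej]; exact hle e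
  have hsum' : ∑ e, shift κ i j e + 2 = (k + 1) * c := by rw [sum_shift κ hij hi, hsum]
  have h1 := ciHilbert_sub_two_le_card_divSet hc hle' hsum' (c + 1)
  have h3c : 3 * c ≤ (k + 1) * c := Nat.mul_le_mul_right c (by omega)
  have h2 := card_divSet_shift_lt κ hij hi hij' (M := c + 1) (by omega) (by omega)
  omega

end Combinatorics

/-! ## The equality clause for the Gorenstein ideal `Ann ℓ`: the Hilbert function in degrees `1` and `2` -/

section Functional

open MvPolynomial Module Movasati2016 Literature.RingTheory.MvPolynomial Literature.AlgebraicGeometry.Kloosterman2025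

attribute [local instance] MvPolynomial.gradedAlgebra

variable {K : Type*} [Field K] {m d : ℕ}

open Classical in
/-- **Theorem 1.3, equality clause — Hilbert-function form.** Let `ℓ ≠ 0` be a functional on `K[x_0,…,x_{m−1}]`
concentrated in degree `t = (k+1)(d−2)`, killing every monomial with an exponent `≥ d − 1` (`J^F ⊆ Ann ℓ`), with
`k ≥ 2` (`n = 2k ≥ 4`) and `d ≥ 4`. If `HF_{Ann ℓ}(d)` ATTAINS the second value `ciHilbert(2, d−2, (d−1)^k)(d)`
(`= C(n/2+d,d) + C(n/2+d−1,d−1) − (3n²/8+9n/4+2)`, "the equality in (desteo2)"), then `HF_{Ann ℓ}(1) = k + 2` — i.e.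
`(Ann ℓ)_1` consists of exactly `m − (k+2)` (`= n/2` for `m = n+2`) independent linear forms, the `L_0, L_2, …, L_{n−2}`
of (7.5) — and `HF_{Ann ℓ}(2) ≤ C(k+3, 2) − 1`, one less than the number of quadratic monomials in the `k + 2`
standard variables (room for the quadric `C_n` of (7.5)). Printed route: equality pins the degree-`d` standard monomials
(Case 1: the divisors of the socle standard monomial `x^α`, which then has the pre-final shape; Case 2: the divisors of
`x^α = x_F^{d−2}` together with those of the degree-`(σ−1)` standard monomial `x^{α'}`), the initial ideal is generated in
degrees `≤ d`, and duality `HF(e) = HF(σ−e)` (tree `hilbert_annIdeal_symm`) gives degrees `1, 2`.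
[cite: Villaflorloyola2021, Theorem 1.3, §7 (7.2)–(7.5), Proposition 3.3] -/
theorem hilbert_one_two_of_hilbert_eq_secondGap {k : ℕ} (hk : 2 ≤ k) (hd : 4 ≤ d)
    (ℓ : MvPolynomial (Fin m) K →ₗ[K] K)
    (hbox : ∀ s : Fin m →₀ ℕ, (∃ e, d - 1 ≤ s e) → ℓ (monomial s 1) = 0)
    {t : ℕ} (hℓ : ∀ q, ℓ (homogeneousComponent t q) = ℓ q) (ht : t = (k + 1) * (d - 2)) (hne : ℓ ≠ 0)
    (heq : finrank K (homogeneousSubmodule (Fin m) K d) - finrank K (idealDegree (annIdeal ℓ) d) =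
      ciHilbert (2 :: (d - 2) :: List.replicate k (d - 1)) d) :
    finrank K (homogeneousSubmodule (Fin m) K 1) - finrank K (idealDegree (annIdeal ℓ) 1) = k + 2 ∧
      finrank K (homogeneousSubmodule (Fin m) K 2) - finrank K (idealDegree (annIdeal ℓ) 2) + 1 ≤
        (k + 3).choose 2 := by
  set mo : MonomialOrder (Fin m) := MonomialOrder.degLex with hmo
  set LE := leadingExponents mo (annIdeal ℓ) with hLEdef
  have hup : IsUpperSet LE := isUpperSet_leadingExponents mo _
  -- standard monomials of degree `u`, counting `HF(u)`
  set std : ℕ → Finset (Fin m →₀ ℕ) := fun u =>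
    ((univ : Finset (Fin m)).finsuppAntidiag u).filter fun a => a ∉ LE with hstd
  have hmem_std : ∀ u (β : Fin m →₀ ℕ), β ∈ std u ↔ (∑ i, β i = u) ∧ β ∉ LE := by
    intro u β
    rw [hstd, Finset.mem_filter, Literature.RingTheory.MvPolynomial.mem_finsuppAntidiag_univ_iff,
      Finsupp.degree_eq_sum]
  have hHF : ∀ u, finrank K (homogeneousSubmodule (Fin m) K u) - finrank K (idealDegree (annIdeal ℓ) u) =
      (std u).card := fun u => hilbert_annIdeal_eq_card_standard mo ℓ hℓ u
  -- the socle standard monomial `x^α` (in the box)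
  obtain ⟨α, hαsum, hαE, hαbox⟩ := exists_standard_socle mo ℓ hbox hℓ hne
  have hαsum' : ∑ e, (⇑α) e = (k + 1) * (d - 2) := by rw [← ht]; exact hαsum
  -- divisors of standard monomials are standard; standard exponents lie in the box
  have hdiv : ∀ β : Fin m →₀ ℕ, β ≤ α → β ∉ LE := fun β hβ hβE => hαE (hup hβ hβE)
  have hstd_box : ∀ β : Fin m →₀ ℕ, β ∉ LE → ∀ e, β e ≤ d - 2 := by
    intro β hβ e
    by_contra h
    push Not at h
    refine hβ ⟨monomial β 1, Movasati2017.monomial_mem_annIdeal_of_le ℓ hbox ⟨e, by omega⟩,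
      monomial_eq_zero.not.mpr one_ne_zero, ?_⟩
    rw [MonomialOrder.degree_monomial, if_neg one_ne_zero]
  -- counting transfers between `std u` (finsupps) and finsets of functions
  have hcount_le : ∀ (u : ℕ) (A : Finset (Fin m → ℕ)), (∀ γ : Fin m →₀ ℕ, γ ∈ std u → ⇑γ ∈ A) →
      (std u).card ≤ A.card := by
    intro u A hA
    exact Finset.card_le_card_of_injOn (fun γ => ⇑γ) (fun γ hγ => Finset.mem_coe.mpr (hA γ (Finset.mem_coe.mp hγ)))
      (fun γ₁ _ γ₂ _ h => DFunLike.coe_injective h)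
  have hdiv_card : ∀ κ : Fin m →₀ ℕ, κ ∉ LE → ∀ u, (divSet (⇑κ) u).card ≤ (std u).card := by
    intro κ hκ u
    refine Finset.card_le_card_of_injOn (fun j => Finsupp.equivFunOnFinite.symm j) (fun j hj => ?_)
      (fun j₁ _ j₂ _ h => Finsupp.equivFunOnFinite.symm.injective h)
    obtain ⟨hle, hsum⟩ := mem_divSet.mp (Finset.mem_coe.mp hj)
    rw [Finset.mem_coe, hmem_std]
    exact ⟨by simpa using hsum, fun hin => hκ (hup (show Finsupp.equivFunOnFinite.symm j ≤ κ from
      fun e => by simpa using hle e) hin)⟩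
  -- degrees and duality
  have ht2d : d + 2 ≤ t := by
    rw [ht]
    have : 3 * (d - 2) ≤ (k + 1) * (d - 2) := Nat.mul_le_mul_right _ (by omega)
    omega
  have hsymm1 := hilbert_annIdeal_symm (σ := Fin m) hℓ (a := 1) (b := t - 1) (by omega)
  have hsymm2 := hilbert_annIdeal_symm (σ := Fin m) hℓ (a := 2) (b := t - 2) (by omega)
  rw [hHF 1, hHF (t - 1)] at hsymm1
  rw [hHF 2, hHF (t - 2)] at hsymm2
  rw [hHF 1, hHF 2]
  by_cases hmid : ∃ e, 0 < α e ∧ α e < d - 2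
  · /- Case 1 (printed): `x^α` is not concentrated. Then `HF(d) ≥ #S^d_α ≥` the bound, so both are equalities:
    `x^α` has the pre-final support data, and the degree-`d` standard monomials are the divisors of `x^α`. -/
    have h1 : ciHilbert (2 :: (d - 2) :: List.replicate k (d - 1)) d ≤ (divSet (⇑α) d).card := by
      have h := ciHilbert_preFinal_le_card_divSet (c := d - 2) (k := k) (κ := ⇑α) hαbox hαsum' hmid d
      rwa [show d - 2 + 1 = d - 1 by omega] at h
    have hcount_d : (divSet (⇑α) d).card = (std d).card := by
      apply le_antisymm (hdiv_card α hαE d)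
      rw [← hHF d, heq]
      exact h1
    obtain ⟨hsuppα, e₀, he₀⟩ := card_support_eq_and_exists_eq_one_of_card_divSet_eq (c := d - 2) (k := k) hk
      (κ := ⇑α) hαbox hαsum' hmid
      (by rw [show d - 2 + 2 = d by omega, show d - 2 + 1 = d - 1 by omega, hcount_d, ← hHF d, heq])
    -- (4) standard monomials of degree `d` divide `x^α`
    have hstd_d : ∀ β : Fin m →₀ ℕ, (∑ i, β i = d) → β ∉ LE → β ≤ α := by
      intro β hβd hβE
      have himg : (divSet (⇑α) d).image (fun j => Finsupp.equivFunOnFinite.symm j) = std d := by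
        refine Finset.eq_of_subset_of_card_le (fun β' hβ' => ?_) ?_
        · obtain ⟨j, hj, rfl⟩ := Finset.mem_image.mp hβ'
          obtain ⟨hle, hsum⟩ := mem_divSet.mp hj
          rw [hmem_std]
          exact ⟨by simpa using hsum, hdiv _ fun e => by simpa using hle e⟩
        · rw [Finset.card_image_of_injective _ Finsupp.equivFunOnFinite.symm.injective, hcount_d]
      have hβ : β ∈ (divSet (⇑α) d).image (fun j => Finsupp.equivFunOnFinite.symm j) := by
        rw [himg, hmem_std]
        exact ⟨hβd, hβE⟩
      obtain ⟨j, hj, rfl⟩ := Finset.mem_image.mp hβ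
      intro e
      simpa using (mem_divSet.mp hj).1 e
    -- (5) in every degree `u ≥ d`, standard monomials divide `x^α` (the initial ideal is generated in degree `≤ d`)
    have hstd_le : ∀ u, d ≤ u → ∀ β : Fin m →₀ ℕ, (∑ i, β i = u) → β ∉ LE → β ≤ α := by
      intro u hu β hβu hβE
      by_contra hnot
      obtain ⟨e, he⟩ : ∃ e, α e < β e := by
        by_contra h
        push Not at h
        exact hnot fun e => h e
      -- a degree-`d` divisor `β'` of `β` with `β'_e ≥ α_e + 1`
      set g : Fin m → ℕ := Function.update (fun _ => 0) e (α e + 1) with hg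
      have hgle : ∀ x, g x ≤ β x := fun x => by
        by_cases hx : x = e
        · rw [hx, hg, Function.update_self]; omega
        · rw [hg, Function.update_of_ne hx]; exact Nat.zero_le _
      have hgsum : ∑ x, g x = α e + 1 := by
        have := sum_update_add₂ (fun _ : Fin m => 0) e (α e + 1)
        simp only [Finset.sum_const_zero, zero_add] at this
        rw [hg]; exact this
      obtain ⟨γ', hγ'1, hγ'2, hγ'3⟩ := exists_between_sum_eq g (⇑β) hgle (M := d)
        (by rw [hgsum]; have := hαbox e; omega) (by rw [hβu]; exact hu)
      set β' : Fin m →₀ ℕ := Finsupp.equivFunOnFinite.symm γ' with hβ'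
      have hβ'le : β' ≤ β := fun x => by rw [hβ', Finsupp.coe_equivFunOnFinite_symm]; exact hγ'2 x
      have hβ'E : β' ∉ LE := fun hin => hβE (hup hβ'le hin)
      have hβ'α := hstd_d β' (by simpa [hβ'] using hγ'3) hβ'E
      have h1 := hβ'α e
      have h2 := hγ'1 e
      rw [hβ', Finsupp.coe_equivFunOnFinite_symm] at h1
      rw [hg, Function.update_self] at h2
      omega
    -- `HF(1) = HF(t−1) ≤ #S^{t−1}_α = #supp α = k + 2 ≤ HF(1)`
    have hsub1 : 1 ≤ ∑ e, (⇑α) e := by rw [hαsum]; omega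
    have hHF1_le : (std (t - 1)).card ≤ k + 2 := by
      calc (std (t - 1)).card ≤ (divSet (⇑α) (t - 1)).card := hcount_le (t - 1) _ (fun γ hγ => by
              obtain ⟨hsum, hγE⟩ := (hmem_std _ γ).mp hγ
              exact mem_divSet.mpr ⟨hstd_le (t - 1) (by omega) γ hsum hγE, hsum⟩)
        _ = k + 2 := by
            rw [show t - 1 = ∑ e, (⇑α) e - 1 by rw [hαsum], card_divSet_sum_sub_one _ hsub1, hsuppα]
    have hHF1_ge : k + 2 ≤ (std 1).card := by
      calc k + 2 = (divSet (⇑α) 1).card := by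
              rw [card_divSet_symm (⇑α) (M := 1) hsub1, card_divSet_sum_sub_one _ hsub1, hsuppα]
        _ ≤ (std 1).card := hdiv_card α hαE 1
    -- `HF(2) = HF(t−2) ≤ #S^{t−2}_α = #S^2_α ≤ C(k+3,2) − 1`
    have hle2 : (std (t - 2)).card ≤ (divSet (⇑α) (t - 2)).card := hcount_le (t - 2) _ (fun γ hγ => by
      obtain ⟨hsum, hγE⟩ := (hmem_std _ γ).mp hγ
      exact mem_divSet.mpr ⟨hstd_le (t - 2) (by omega) γ hsum hγE, hsum⟩)
    have hs := card_divSet_symm (⇑α) (M := 2) (by omega)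
    rw [hαsum] at hs
    have h2lt := card_divSet_two_lt (κ := ⇑α) he₀
    rw [hsuppα] at h2lt
    have h3 : (k + 3).choose 2 = (k + 2 + 1).choose 2 := rfl
    constructor
    · omega
    · omega
  · /- Case 2 (printed): `x^α = x_F^{d−2}`, `#F = k+1`; equality in (desteo2) means (igualdad1) fails by exactly the
    greedy count. -/
    push Not at hmid
    have hconc : ∀ e, α e = 0 ∨ α e = d - 2 := fun e => by
      have h1 := hmid e; have h2 := hαbox e
      by_cases h0 : α e = 0
      · exact Or.inl h0
      · exact Or.inr (le_antisymm h2 (h1 (Nat.pos_of_ne_zero h0)))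
    set F : Finset (Fin m) := univ.filter fun e => α e = d - 2 with hF
    have hαF : (⇑α : Fin m → ℕ) = fun e => if e ∈ F then d - 2 else 0 := by
      funext e
      by_cases he : e ∈ F
      · rw [if_pos he]; simpa [hF] using he
      · rw [if_neg he]
        have hne' : α e ≠ d - 2 := by simpa [hF] using he
        rcases hconc e with h0 | h2
        · exact h0
        · exact absurd h2 hne'
    have hcardF : F.card = k + 1 := by
      have h1 : ∑ e, (⇑α) e = F.card * (d - 2) := by
        rw [hαF, ← Finset.sum_filter, Finset.filter_mem_eq_inter, Finset.univ_inter, Finset.sum_const, smul_eq_mul]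
      rw [hαsum, ht] at h1
      exact (Nat.eq_of_mul_eq_mul_right (by omega) h1).symm
    -- if there are more standard monomials of degree `u` than divisors of `x^α`, one of them does not divide `x^α`,
    -- and it involves a variable `x_w`, `w ∉ F`
    have hexists : ∀ u, (divSet (⇑α) u).card < (std u).card →
        ∃ β : Fin m →₀ ℕ, (∑ i, β i = u) ∧ β ∉ LE ∧ ∃ w, w ∉ F ∧ 1 ≤ β w := by
      intro u hlt
      have himg : ((divSet (⇑α) u).image fun j => Finsupp.equivFunOnFinite.symm j).card < (std u).card := by
        rwa [Finset.card_image_of_injective _ Finsupp.equivFunOnFinite.symm.injective]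
      obtain ⟨β, hβstd, hβnot⟩ := Finset.exists_mem_notMem_of_card_lt_card himg
      obtain ⟨hβsum, hβE⟩ := (hmem_std u β).mp hβstd
      have hnotle : ¬ β ≤ α := by
        intro hle
        refine hβnot (Finset.mem_image.mpr ⟨⇑β, mem_divSet.mpr ⟨fun e => hle e, hβsum⟩, ?_⟩)
        exact Finsupp.equivFunOnFinite_symm_coe β
      obtain ⟨w, hw⟩ : ∃ w, α w < β w := by
        by_contra h
        push Not at h
        exact hnotle fun e => h e
      have hαw : α w = 0 := by
        have := hstd_box β hβE w
        rcases hconc w with h0 | h2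
        · exact h0
        · omega
      refine ⟨β, hβsum, hβE, w, ?_, by omega⟩
      simp only [hF, Finset.mem_filter, Finset.mem_univ, true_and]
      omega
    -- degree `d`: `#S^d_α` is Movasati's value, (dessalfa2) is strict by exactly the greedy count `G`
    have hcount_d : (divSet (⇑α) d).card = ciHilbert (List.replicate (k + 1) (d - 1)) d := by
      rw [hαF, card_divSet_indicator, hcardF, show d - 2 + 1 = d - 1 by omega]
    have hsplit := ciHilbert_secondGap_split (d - 2) (by omega) (List.replicate k (d - 1))
    rw [show d - 2 + 1 = d - 1 by omega, show d - 2 + 2 = d by omega, show d - 2 - 1 = d - 3 by omega] at hsplit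
    have hstd_d_card : (std d).card = (divSet (⇑α) d).card + ciHilbert ((d - 3) :: List.replicate k (d - 1)) (d - 1) := by
      rw [← hHF d, heq, hcount_d, List.replicate_succ, ← hsplit]
    have hG1 : 1 ≤ ciHilbert ((d - 3) :: List.replicate k (d - 1)) (d - 1) := by
      refine le_trans ?_ (ciHilbert_le_ciHilbert_cons (d - 3) _ (j := 0) (by omega) (Nat.zero_le _))
      rw [Nat.sub_zero]
      have hkd : d - 1 ≤ k * (d - 2) := by
        have : 2 * (d - 2) ≤ k * (d - 2) := Nat.mul_le_mul_right _ hk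
        omega
      have h := one_le_ciHilbert_replicate (k := k) (c := d - 2) (M := d - 1) hkd
      rwa [show d - 2 + 1 = d - 1 by omega] at h
    have hlt_d : (divSet (⇑α) d).card < (std d).card := by rw [hstd_d_card]; omega
    obtain ⟨μ, -, hμE, v, hvF, hμv⟩ := hexists d hlt_d
    -- degree `1`: the `k + 2` coordinate vectors `e_e`, `e ∈ F ∪ {v}`, are standard
    have hstd1 : k + 2 ≤ (std 1).card := by
      have hinj : Function.Injective fun e : Fin m => Finsupp.single e (1 : ℕ) :=
        Finsupp.single_left_injective one_ne_zero
      have hsub : (insert v F).image (fun e => Finsupp.single e (1 : ℕ)) ⊆ std 1 := by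
        intro β hβ
        obtain ⟨e, he, rfl⟩ := Finset.mem_image.mp hβ
        rw [hmem_std]
        refine ⟨by simp, ?_⟩
        rcases Finset.mem_insert.mp he with rfl | heF
        · exact fun hin => hμE (hup (Finsupp.single_le_iff.mpr hμv) hin)
        · have hαe : α e = d - 2 := by simpa [hF] using heF
          exact hdiv _ (Finsupp.single_le_iff.mpr (by rw [hαe]; omega))
      calc k + 2 = (insert v F).card := by rw [Finset.card_insert_of_notMem hvF, hcardF]
        _ = ((insert v F).image fun e => Finsupp.single e (1 : ℕ)).card :=
            (Finset.card_image_of_injective _ hinj).symm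
        _ ≤ (std 1).card := Finset.card_le_card hsub
    -- duality `HF(t−1) = HF(1) ≥ k + 2 > k + 1 = #S^{t−1}_α`: a standard `x^β` of degree `t−1` not dividing `x^α`
    have hval : (divSet (⇑α) (t - 1)).card = k + 1 := by
      rw [hαF, card_divSet_indicator, hcardF, ht]
      exact (ciHilbert_replicate_one_and_sub_one k (c := d - 2) (by omega)).2
    have hlt_t : (divSet (⇑α) (t - 1)).card < (std (t - 1)).card := by rw [hval, ← hsymm1]; omega
    obtain ⟨β, hβsum, hβE, w, hwF, hβw⟩ := hexists (t - 1) hlt_t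
    have hβbox := hstd_box β hβE
    have hαw0 : α w = 0 := by
      have h := congr_fun hαF w
      simp only [if_neg hwF] at h
      exact h
    have hdivβ : ∀ γ : Fin m →₀ ℕ, γ ≤ β → γ ∉ LE := fun γ hγ hγE => hβE (hup hγ hγE)
    -- the degree-`d` divisors of `x^β` through `x_w`: standard, and disjoint from the divisors of `x^α`
    set D : Finset (Fin m → ℕ) := (divSet (⇑β) d).filter fun j => 1 ≤ j w with hD
    have hdisj : Disjoint (divSet (⇑α) d) D := by
      rw [Finset.disjoint_left]
      intro j hjα hjD
      have h1 : j w ≤ α w := (mem_divSet.mp hjα).1 w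
      have h2 := (Finset.mem_filter.mp hjD).2
      omega
    have himg_sub : (divSet (⇑α) d ∪ D).image (fun j => Finsupp.equivFunOnFinite.symm j) ⊆ std d := by
      intro β' hβ'
      obtain ⟨j, hj, rfl⟩ := Finset.mem_image.mp hβ'
      rw [hmem_std]
      rcases Finset.mem_union.mp hj with hj | hj
      · obtain ⟨hle, hs⟩ := mem_divSet.mp hj
        exact ⟨by simpa using hs, hdiv _ fun e => by simpa using hle e⟩
      · obtain ⟨hj, -⟩ := Finset.mem_filter.mp hj
        obtain ⟨hle, hs⟩ := mem_divSet.mp hj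
        exact ⟨by simpa using hs, hdivβ _ fun e => by simpa using hle e⟩
    have hsum_le : (divSet (⇑α) d).card + D.card ≤ (std d).card := by
      rw [← Finset.card_union_of_disjoint hdisj,
        ← Finset.card_image_of_injective _ Finsupp.equivFunOnFinite.symm.injective]
      exact Finset.card_le_card himg_sub
    -- … in bijection with the degree-`(d−1)` divisors of `x^β / x_w`
    set κ : Fin m → ℕ := Function.update (⇑β) w (β w - 1) with hκ
    have hκw : κ w = β w - 1 := by simp [hκ]
    have hκne : ∀ e, e ≠ w → κ e = β e := fun e he => by simp [hκ, he]
    have hDcard : D.card = (divSet κ (d - 1)).card := by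
      refine Finset.card_nbij' (fun j => Function.update j w (j w - 1)) (fun g => Function.update g w (g w + 1))
        (fun j hj => ?_) (fun g hg => ?_) (fun j hj => ?_) (fun g hg => ?_)
      · obtain ⟨hj, hjw⟩ := Finset.mem_filter.mp (Finset.mem_coe.mp hj)
        obtain ⟨hle, hs⟩ := mem_divSet.mp hj
        rw [Finset.mem_coe, mem_divSet]
        refine ⟨fun e => ?_, ?_⟩
        · dsimp only
          by_cases hew : e = w
          · rw [hew, Function.update_self, hκw]; have := hle w; omega
          · rw [Function.update_of_ne hew, hκne e hew]; exact hle e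
        · dsimp only
          have h := sum_update_add₂ j w (j w - 1)
          omega
      · obtain ⟨hle, hs⟩ := mem_divSet.mp (Finset.mem_coe.mp hg)
        rw [Finset.mem_coe, Finset.mem_filter, mem_divSet]
        refine ⟨⟨fun e => ?_, ?_⟩, by simp⟩
        · dsimp only
          by_cases hew : e = w
          · rw [hew, Function.update_self]; have := hle w; rw [hκw] at this; omega
          · rw [Function.update_of_ne hew]; have := hle e; rwa [hκne e hew] at this
        · dsimp only
          have h := sum_update_add₂ g w (g w + 1)
          omega
      · obtain ⟨-, hjw⟩ := Finset.mem_filter.mp (Finset.mem_coe.mp hj)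
        funext e
        dsimp only
        by_cases hew : e = w
        · rw [hew, Function.update_self, Function.update_self]; omega
        · rw [Function.update_of_ne hew, Function.update_of_ne hew]
      · funext e
        dsimp only
        by_cases hew : e = w
        · rw [hew, Function.update_self, Function.update_self]; omega
        · rw [Function.update_of_ne hew, Function.update_of_ne hew]
    have hκle : ∀ e, κ e ≤ d - 2 := fun e => by
      by_cases hew : e = w
      · rw [hew, hκw]; have := hβbox w; omega
      · rw [hκne e hew]; exact hβbox e
    have hκsum : ∑ e, κ e + 2 = (k + 1) * (d - 2) := by
      have h := sum_update_add₂ (⇑β) w (β w - 1)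
      rw [← ht]
      change ∑ e, κ e + β w = ∑ e, (⇑β) e + (β w - 1) at h
      omega
    have hgreedy := ciHilbert_sub_two_le_card_divSet (c := d - 2) (k := k) (by omega) hκle hκsum (d - 1)
    rw [show d - 2 - 1 = d - 3 by omega, show d - 2 + 1 = d - 1 by omega] at hgreedy
    -- EQUALITY: `#D` is exactly the greedy count, and the degree-`d` standard monomials are exactly `S^d_α ⊔ D`
    have hDG : D.card = ciHilbert ((d - 3) :: List.replicate k (d - 1)) (d - 1) := by
      rw [hDcard]; rw [hDcard] at hsum_le; omega
    have hstd_d : ∀ γ : Fin m →₀ ℕ, (∑ i, γ i = d) → γ ∉ LE → γ ≤ α ∨ γ ≤ β := by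
      intro γ hγd hγE
      have himg : (divSet (⇑α) d ∪ D).image (fun j => Finsupp.equivFunOnFinite.symm j) = std d := by
        refine Finset.eq_of_subset_of_card_le himg_sub ?_
        rw [Finset.card_image_of_injective _ Finsupp.equivFunOnFinite.symm.injective,
          Finset.card_union_of_disjoint hdisj, hstd_d_card, hDG]
      have hγ : γ ∈ (divSet (⇑α) d ∪ D).image (fun j => Finsupp.equivFunOnFinite.symm j) := by
        rw [himg, hmem_std]
        exact ⟨hγd, hγE⟩
      obtain ⟨j, hj, rfl⟩ := Finset.mem_image.mp hγ
      rcases Finset.mem_union.mp hj with hj | hj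
      · left; intro e; simpa using (mem_divSet.mp hj).1 e
      · right
        obtain ⟨hj, -⟩ := Finset.mem_filter.mp hj
        intro e; simpa using (mem_divSet.mp hj).1 e
    -- propagation: in every degree `u ≥ d`, a standard monomial divides `x^α` or `x^β`
    have hstd_le : ∀ u, d ≤ u → ∀ γ : Fin m →₀ ℕ, (∑ i, γ i = u) → γ ∉ LE → γ ≤ α ∨ γ ≤ β := by
      intro u hu γ hγu hγE
      by_contra hnot
      push Not at hnot
      obtain ⟨hna, hnb⟩ := hnot
      obtain ⟨i, hi⟩ : ∃ i, α i < γ i := by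
        by_contra h
        push Not at h
        exact hna fun e => h e
      obtain ⟨j, hj⟩ : ∃ j, β j < γ j := by
        by_contra h
        push Not at h
        exact hnb fun e => h e
      have hγbox := hstd_box γ hγE
      have hαi : α i = 0 := by
        rcases hconc i with h0 | h2
        · exact h0
        · have := hγbox i; omega
      -- the forced part: `x_i · x_j^{β_j + 1}` (or `x_j^{β_j+1}` if `i = j`), of degree `≤ d`
      set g : Fin m → ℕ := Function.update (Function.update (fun _ => 0) i 1) j (β j + 1) with hg
      have hgj : g j = β j + 1 := by rw [hg, Function.update_self]
      have hgi : 1 ≤ g i := by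
        by_cases hij : i = j
        · rw [hij, hgj]; omega
        · rw [hg, Function.update_of_ne hij, Function.update_self]
      have hg0 : ∀ x, x ≠ i → x ≠ j → g x = 0 := fun x hxi hxj => by
        rw [hg, Function.update_of_ne hxj, Function.update_of_ne hxi]
      have hgle : ∀ x, g x ≤ γ x := fun x => by
        by_cases hxj : x = j
        · rw [hxj, hgj]; omega
        by_cases hxi : x = i
        · rw [hxi, hg, Function.update_of_ne (show i ≠ j from fun h => hxj (hxi.trans h)), Function.update_self]
          omega
        rw [hg0 x hxi hxj]; exact Nat.zero_le _
      have hgsum : ∑ x, g x ≤ β j + 2 := by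
        have h1 := sum_update_add₂ (Function.update (fun _ : Fin m => (0 : ℕ)) i 1) j (β j + 1)
        have h2 := sum_update_add₂ (fun _ : Fin m => (0 : ℕ)) i 1
        simp only [Finset.sum_const_zero, zero_add] at h2
        have h3 : Function.update (fun _ : Fin m => (0 : ℕ)) i 1 j ≤ 1 := by
          by_cases hji : j = i
          · rw [hji, Function.update_self]
          · rw [Function.update_of_ne hji]; exact Nat.zero_le _
        rw [← hg] at h1
        omega
      obtain ⟨γ', hγ'1, hγ'2, hγ'3⟩ := exists_between_sum_eq g (⇑γ) hgle (M := d)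
        (by have := hβbox j; omega) (by rw [hγu]; exact hu)
      set γ'' : Fin m →₀ ℕ := Finsupp.equivFunOnFinite.symm γ' with hγ''
      have hγ''le : γ'' ≤ γ := fun x => by rw [hγ'', Finsupp.coe_equivFunOnFinite_symm]; exact hγ'2 x
      have hγ''E : γ'' ∉ LE := fun hin => hγE (hup hγ''le hin)
      rcases hstd_d γ'' (by simpa [hγ''] using hγ'3) hγ''E with h | h
      · have h1 := h i
        have h2 := hγ'1 i
        rw [hγ'', Finsupp.coe_equivFunOnFinite_symm] at h1
        omega
      · have h1 := h j
        have h2 := hγ'1 j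
        rw [hγ'', Finsupp.coe_equivFunOnFinite_symm] at h1
        omega
    -- `HF(1) = k + 2`: `HF(t−1) ≤ #S^{t−1}_α + #S^{t−1}_β = (k+1) + 1`
    have hHF1_le : (std (t - 1)).card ≤ k + 2 := by
      calc (std (t - 1)).card ≤ (divSet (⇑α) (t - 1) ∪ divSet (⇑β) (t - 1)).card :=
            hcount_le (t - 1) _ (fun γ hγ => by
              obtain ⟨hsum, hγE⟩ := (hmem_std _ γ).mp hγ
              rcases hstd_le (t - 1) (by omega) γ hsum hγE with h | h
              · exact Finset.mem_union_left _ (mem_divSet.mpr ⟨h, hsum⟩)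
              · exact Finset.mem_union_right _ (mem_divSet.mpr ⟨h, hsum⟩))
        _ ≤ (divSet (⇑α) (t - 1)).card + (divSet (⇑β) (t - 1)).card := Finset.card_union_le _ _
        _ = (k + 1) + 1 := by rw [hval, ← hβsum, divSet_sum_self, Finset.card_singleton]
    have hHF1 : (std 1).card = k + 2 := by omega
    -- `supp β ⊆ F ∪ {w}` (else `k + 3` standard variables)
    have hsuppβ : ∀ x, 0 < β x → x ∈ F ∨ x = w := by
      intro x hx
      by_contra hno
      push Not at hno
      obtain ⟨hxF, hxw⟩ := hno
      have hinj : Function.Injective fun e : Fin m => Finsupp.single e (1 : ℕ) :=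
        Finsupp.single_left_injective one_ne_zero
      have hsub : (insert x (insert w F)).image (fun e => Finsupp.single e (1 : ℕ)) ⊆ std 1 := by
        intro θ hθ
        obtain ⟨e, he, rfl⟩ := Finset.mem_image.mp hθ
        rw [hmem_std]
        refine ⟨by simp, ?_⟩
        rcases Finset.mem_insert.mp he with rfl | he
        · exact hdivβ _ (Finsupp.single_le_iff.mpr (by omega))
        rcases Finset.mem_insert.mp he with rfl | heF
        · exact hdivβ _ (Finsupp.single_le_iff.mpr (by omega))
        · have hαe : α e = d - 2 := by simpa [hF] using heF
          exact hdiv _ (Finsupp.single_le_iff.mpr (by rw [hαe]; omega))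
      have hx' : x ∉ insert w F := by simp [hxw, hxF]
      have hcard : (insert x (insert w F)).card = k + 3 := by
        rw [Finset.card_insert_of_notMem hx', Finset.card_insert_of_notMem hwF, hcardF]
      have h := Finset.card_le_card hsub
      rw [Finset.card_image_of_injective _ hinj, hcard] at h
      omega
    set Sβ : Finset (Fin m) := univ.filter fun x => 0 < β x with hSβ
    have hSβ_sub : Sβ ⊆ insert w F := fun x hx => by
      rcases hsuppβ x (Finset.mem_filter.mp hx).2 with h | h
      · exact Finset.mem_insert_of_mem h
      · rw [h]; exact Finset.mem_insert_self _ _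
    have hwF_card : (insert w F).card = k + 2 := by rw [Finset.card_insert_of_notMem hwF, hcardF]
    have hSβ_card : Sβ.card ≤ k + 2 := by rw [← hwF_card]; exact Finset.card_le_card hSβ_sub
    -- dichotomy: `β_w = 1`, or `x^β` involves at most `k + 1` variables (strictness lemma for Case 2)
    have hkey : β w = 1 ∨ Sβ.card ≤ k + 1 := by
      by_contra hno
      push Not at hno
      obtain ⟨hw1, hcardgt⟩ := hno
      have hSβeq : Sβ = insert w F := Finset.eq_of_subset_of_card_le hSβ_sub (by rw [hwF_card]; omega)
      have hsuppκ : k + 2 ≤ (univ.filter fun x => 0 < κ x).card := by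
        have hsub : insert w F ⊆ univ.filter fun x => 0 < κ x := by
          intro x hx
          rw [Finset.mem_filter]
          refine ⟨Finset.mem_univ _, ?_⟩
          rcases Finset.mem_insert.mp hx with rfl | hxF
          · rw [hκw]; omega
          · have hxw : x ≠ w := fun h => hwF (h ▸ hxF)
            rw [hκne x hxw]
            have hxS : x ∈ Sβ := by rw [hSβeq]; exact Finset.mem_insert_of_mem hxF
            exact (Finset.mem_filter.mp hxS).2
        rw [← hwF_card]; exact Finset.card_le_card hsub
      have hlt := ciHilbert_sub_two_lt_card_divSet_of_support (c := d - 2) (k := k) (by omega) hk hκle hκsum hsuppκ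
      rw [show d - 2 - 1 = d - 3 by omega, show d - 2 + 1 = d - 1 by omega, ← hDcard, hDG] at hlt
      exact lt_irrefl _ hlt
    -- `HF(2) = HF(t−2) ≤ #(S^{t−2}_α ∪ S^{t−2}_β) ≤ C(k+2,2) + (k+2) − 1`
    have hαt2 : (divSet (⇑α) (t - 2)).card = (k + 2).choose 2 := by
      rw [show t - 2 = ∑ e, (⇑α) e - 2 by rw [hαsum], ← card_divSet_symm (⇑α) (M := 2) (by rw [hαsum]; omega),
        hαF, card_divSet_indicator, hcardF]
      exact ciHilbert_replicate_two (c := d - 2) (by omega) (k + 1)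
    have hβt2 : (divSet (⇑β) (t - 2)).card = Sβ.card := by
      rw [show t - 2 = ∑ e, (⇑β) e - 1 by rw [hβsum]; omega]
      exact card_divSet_sum_sub_one _ (by rw [hβsum]; omega)
    have hcover : ∀ γ : Fin m →₀ ℕ, γ ∈ std (t - 2) → ⇑γ ∈ divSet (⇑α) (t - 2) ∪ divSet (⇑β) (t - 2) := by
      intro γ hγ
      obtain ⟨hsum, hγE⟩ := (hmem_std _ γ).mp hγ
      rcases hstd_le (t - 2) (by omega) γ hsum hγE with h | h
      · exact Finset.mem_union_left _ (mem_divSet.mpr ⟨h, hsum⟩)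
      · exact Finset.mem_union_right _ (mem_divSet.mpr ⟨h, hsum⟩)
    have hle2 := hcount_le (t - 2) _ hcover
    have hC : (k + 2 + 1).choose 2 = (k + 2).choose 1 + (k + 2).choose 2 := Nat.choose_succ_succ (k + 2) 1
    rw [Nat.choose_one_right] at hC
    have hunion_le := Finset.card_union_le (divSet (⇑α) (t - 2)) (divSet (⇑β) (t - 2))
    refine ⟨hHF1, ?_⟩
    rcases hkey with hw1 | hsmall
    · -- `x^β / x_w` divides both `x^α` and `x^β`: the union loses one element
      have hκα : κ ∈ divSet (⇑α) (t - 2) := by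
        rw [mem_divSet]
        refine ⟨fun e => ?_, by omega⟩
        by_cases hew : e = w
        · rw [hew, hκw, hw1]; exact Nat.zero_le _
        · rw [hκne e hew]
          rcases Nat.eq_zero_or_pos (β e) with h0 | hpos
          · rw [h0]; exact Nat.zero_le _
          · rcases hsuppβ e hpos with heF | hew'
            · have hαe : α e = d - 2 := by simpa [hF] using heF
              rw [hαe]; exact hβbox e
            · exact absurd hew' hew
      have hκβ : κ ∈ divSet (⇑β) (t - 2) := by
        rw [mem_divSet]
        refine ⟨fun e => ?_, by omega⟩
        by_cases hew : e = w
        · rw [hew, hκw]; omega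
        · rw [hκne e hew]
      have h := Finset.card_union_add_card_inter (divSet (⇑α) (t - 2)) (divSet (⇑β) (t - 2))
      have hinter : 1 ≤ (divSet (⇑α) (t - 2) ∩ divSet (⇑β) (t - 2)).card :=
        Finset.card_pos.mpr ⟨κ, Finset.mem_inter.mpr ⟨hκα, hκβ⟩⟩
      rw [show k + 3 = k + 2 + 1 by rfl]
      omega
    · rw [show k + 3 = k + 2 + 1 by rfl]
      omega

/-! ## The complete intersection of type `(1,…,1,2)` inside `J^{F,λ}` -/

/-- A degree-`1` exponent is a coordinate vector. [folklore] -/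
private theorem exists_eq_single_of_sum_eq_one {s : Fin m →₀ ℕ} (h : ∑ i, s i = 1) :
    ∃ y, s = Finsupp.single y 1 := by
  obtain ⟨y, hy⟩ : ∃ y, s y ≠ 0 := by
    by_contra hno
    push Not at hno
    have : ∑ i, s i = 0 := Finset.sum_eq_zero fun i _ => hno i
    omega
  have hsplit := Finset.sum_eq_add_sum_sdiff_singleton_of_mem (Finset.mem_univ y) (⇑s)
  refine ⟨y, Finsupp.ext fun i => ?_⟩
  rw [Finsupp.single_apply]
  by_cases hi : y = i
  · rw [if_pos hi, ← hi]; omega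
  · rw [if_neg hi]
    have hle : s i ≤ ∑ x ∈ Finset.univ \ {y}, s x :=
      Finset.single_le_sum (f := ⇑s) (fun x _ => Nat.zero_le _) (by simp [Ne.symm hi])
    omega

/-- `x_y`-multiples: `monomial (e_y) c = c • X y`. [folklore] -/
private theorem monomial_single_eq_smul_X (y : Fin m) (c : K) :
    (monomial (Finsupp.single y 1) c : MvPolynomial (Fin m) K) = c • X y := by
  rw [smul_eq_C_mul, C_mul_X_eq_monomial]

open Classical in
/-- **Theorem 1.3, equality clause — as printed: a complete intersection of type `(1,…,1,2)` inside `J^{F,λ}`.**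
Under the hypotheses of `hilbert_one_two_of_hilbert_eq_secondGap` (`k ≥ 2`, `d ≥ 4`, `ℓ ≠ 0` concentrated in degree
`(k+1)(d−2)` killing `J^F`, `HF_{Ann ℓ}(d)` equal to the `(1,…,1,2)` value): `(Ann ℓ)_1` has dimension `m − (k+2)`
(`= n/2` linear forms `L_0, …, L_{n/2−1}` for `m = n + 2`), and there is a quadric `C ∈ Ann ℓ` which does NOT lie in the
ideal generated by the linear forms of `Ann ℓ` — so `Z := V(L_0, …, L_{n/2−1}, C) ⊆ ℙ^{m−1}` is a complete intersection of
type `(1,…,1,2)` with `I(Z) = (L_0,…,L_{n/2−1},C) ⊆ Ann ℓ = J^{F,λ}` ("there exists a complete intersection `Z ⊆ ℙ^{n+1}` of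
type `(1,1,…,1,2)` such that `I(Z) ⊆ J^{F,λ}`"; the printed (7.5): `LT(L_i) = x_i`, `LT(C_n) = x_n²`). Proof: for any
monomial order the `k+2` standard variables `x_v` span a complement `R` of `(Ann ℓ)_1` in `S_1` (every `x_p` lies in
`(Ann ℓ)_1 ⊕ R`, by induction along the order using the linear form with leading term `x_p`); the substitution
`x_p ↦ r_p` (`x_p = L'_p + r_p`, `L'_p ∈ (Ann ℓ)_1`, `r_p ∈ R`) is an algebra endomorphism `φ ≡ id (mod Ann ℓ)` killing
`(Ann ℓ)_1` (as `Ann ℓ ∩ R = 0`) and not raising leading monomials; `HF(2) < C(k+3,2)` yields a quadric `C ∈ Ann ℓ` whose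
leading monomial `x^μ` has standard variables only, so `coeff_μ φ(C) = LC(C) ≠ 0` and `C ∉ (L'_p) = ((Ann ℓ)_1) ⊆ ker φ`.
[cite: Villaflorloyola2021, Theorem 1.3, §7 (7.5)] -/
theorem exists_quadric_not_mem_span_linearForms_of_hilbert_eq_secondGap {k : ℕ} (hk : 2 ≤ k) (hd : 4 ≤ d)
    (ℓ : MvPolynomial (Fin m) K →ₗ[K] K)
    (hbox : ∀ s : Fin m →₀ ℕ, (∃ e, d - 1 ≤ s e) → ℓ (monomial s 1) = 0)
    {t : ℕ} (hℓ : ∀ q, ℓ (homogeneousComponent t q) = ℓ q) (ht : t = (k + 1) * (d - 2)) (hne : ℓ ≠ 0)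
    (heq : finrank K (homogeneousSubmodule (Fin m) K d) - finrank K (idealDegree (annIdeal ℓ) d) =
      ciHilbert (2 :: (d - 2) :: List.replicate k (d - 1)) d) :
    finrank K (idealDegree (annIdeal ℓ) 1) + (k + 2) = m ∧
      ∃ C : MvPolynomial (Fin m) K, C ∈ annIdeal ℓ ∧ C.IsHomogeneous 2 ∧
        C ∉ Ideal.span ((idealDegree (annIdeal ℓ) 1 : Submodule K (MvPolynomial (Fin m) K)) :
          Set (MvPolynomial (Fin m) K)) := by
  obtain ⟨hHF1, hHF2⟩ := hilbert_one_two_of_hilbert_eq_secondGap hk hd ℓ hbox hℓ ht hne heq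
  set mo : MonomialOrder (Fin m) := MonomialOrder.degLex with hmo
  set I := annIdeal ℓ with hIdef
  have hI : ∀ f ∈ I, ∀ e : ℕ, homogeneousComponent e f ∈ I := fun f hf e => homogeneousComponent_mem_annIdeal hℓ hf e
  set LE := leadingExponents mo I with hLEdef
  have hup : IsUpperSet LE := isUpperSet_leadingExponents mo _
  set std : ℕ → Finset (Fin m →₀ ℕ) := fun u =>
    ((univ : Finset (Fin m)).finsuppAntidiag u).filter fun a => a ∉ LE with hstd
  have hmem_std : ∀ u (β : Fin m →₀ ℕ), β ∈ std u ↔ (∑ i, β i = u) ∧ β ∉ LE := by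
    intro u β
    rw [hstd, Finset.mem_filter, Literature.RingTheory.MvPolynomial.mem_finsuppAntidiag_univ_iff,
      Finsupp.degree_eq_sum]
  have hHF : ∀ u, finrank K (homogeneousSubmodule (Fin m) K u) - finrank K (idealDegree I u) =
      (std u).card := fun u => hilbert_annIdeal_eq_card_standard mo ℓ hℓ u
  rw [hHF 1] at hHF1
  rw [hHF 2] at hHF2
  -- the standard variables
  set V : Finset (Fin m) := univ.filter fun y => Finsupp.single y 1 ∉ LE with hV
  have hmemV : ∀ y, y ∈ V ↔ Finsupp.single y 1 ∉ LE := fun y => by simp [hV]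
  have hsum_single : ∀ y : Fin m, ∑ i, (Finsupp.single y 1 : Fin m →₀ ℕ) i = 1 := fun y => by
    rw [← Finsupp.degree_eq_sum, Finsupp.degree_single]
  have hstd1 : std 1 = V.image fun y => Finsupp.single y 1 := by
    ext s
    rw [hmem_std, Finset.mem_image]
    constructor
    · rintro ⟨hsum, hsE⟩
      obtain ⟨y, rfl⟩ := exists_eq_single_of_sum_eq_one hsum
      exact ⟨y, (hmemV y).mpr hsE, rfl⟩
    · rintro ⟨y, hy, rfl⟩
      exact ⟨hsum_single y, (hmemV y).mp hy⟩
  have hVcard : V.card = k + 2 := by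
    rw [← hHF1, hstd1, Finset.card_image_of_injective _ (Finsupp.single_left_injective one_ne_zero)]
  -- `dim (Ann ℓ)_1 = m − (k + 2)`
  have hS1 : finrank K (homogeneousSubmodule (Fin m) K 1) = m := by
    rw [Literature.RingTheory.HilbertSamuel.finrank_homogeneousSubmodule_fin, Nat.add_sub_cancel_left,
      Nat.choose_one_right]
  haveI : Module.Finite K (homogeneousSubmodule (Fin m) K 1) :=
    Module.Finite.iff_fg.mpr (homogeneousSubmodule_fg _ K 1)
  have hle1 : finrank K (idealDegree I 1) ≤ finrank K (homogeneousSubmodule (Fin m) K 1) :=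
    Submodule.finrank_mono inf_le_right
  have hfin : finrank K (idealDegree I 1) + (k + 2) = m := by have := hHF 1; omega
  refine ⟨hfin, ?_⟩
  -- a leading exponent `μ` of degree `2` on the standard variables (`HF(2) < C(k+3,2)`)
  obtain ⟨μ, hμsum, hμV, hμLE⟩ : ∃ μ : Fin m →₀ ℕ, (∑ i, μ i = 2) ∧ (∀ y, μ y ≠ 0 → y ∈ V) ∧ μ ∈ LE := by
    by_contra hno
    push Not at hno
    have hsub : (divSet (fun y => if y ∈ V then 2 else 0) 2).image (fun j => Finsupp.equivFunOnFinite.symm j) ⊆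
        std 2 := by
      intro s hs
      obtain ⟨j, hj, rfl⟩ := Finset.mem_image.mp hs
      obtain ⟨hle, hsum⟩ := mem_divSet.mp hj
      rw [hmem_std]
      refine ⟨by simpa using hsum, hno _ (by simpa using hsum) fun y hy => ?_⟩
      by_contra hyV
      have h := hle y
      rw [if_neg hyV] at h
      exact hy (by simpa using h)
    have hcard := Finset.card_le_card hsub
    rw [Finset.card_image_of_injective _ Finsupp.equivFunOnFinite.symm.injective, card_divSet_indicator, hVcard,
      ciHilbert_replicate_two (le_rfl : 2 ≤ 2)] at hcard
    have : (k + 3).choose 2 = (k + 2 + 1).choose 2 := rfl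
    omega
  obtain ⟨g, hgI, hg0, hgdeg⟩ := hμLE
  have hμdeg : (mo.degree g).degree = 2 := by rw [hgdeg, Finsupp.degree_eq_sum]; exact hμsum
  obtain ⟨hC0, hCdeg⟩ := degree_homogeneousComponent_eq mo hg0 hμdeg
  rw [hgdeg] at hCdeg
  set C := homogeneousComponent 2 g with hCdef
  refine ⟨C, hI g hgI 2, homogeneousComponent_isHomogeneous 2 g, ?_⟩
  -- the span `R` of the standard variables; `Ann ℓ ∩ R = 0`
  set R : Submodule K (MvPolynomial (Fin m) K) :=
    restrictSupport K ((fun v => Finsupp.single v 1) '' (↑V : Set (Fin m))) with hR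
  have hmemR : ∀ f : MvPolynomial (Fin m) K, f ∈ R ↔ ∀ s ∈ f.support, ∃ v ∈ V, s = Finsupp.single v 1 := by
    intro f
    rw [hR, mem_restrictSupport_iff]
    constructor
    · intro h s hs
      obtain ⟨v, hv, hvs⟩ := h (Finset.mem_coe.mpr hs)
      exact ⟨v, Finset.mem_coe.mp hv, hvs.symm⟩
    · intro h s hs
      obtain ⟨v, hv, rfl⟩ := h s (Finset.mem_coe.mp hs)
      exact ⟨v, Finset.mem_coe.mpr hv, rfl⟩
  have hXR : ∀ v ∈ V, (X v : MvPolynomial (Fin m) K) ∈ R := by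
    intro v hv
    rw [hmemR]
    intro s hs
    rw [support_X, Finset.mem_singleton] at hs
    exact ⟨v, hv, hs⟩
  have hIR : ∀ f, f ∈ I → f ∈ R → f = 0 := by
    intro f hfI hfR
    by_contra hf0
    obtain ⟨v, hv, hvs⟩ := (hmemR f).mp hfR _ (mo.degree_mem_support hf0)
    exact (hmemV v).mp hv ⟨f, hfI, hf0, hvs⟩
  -- every variable lies in `(Ann ℓ)_1 ⊕ R` (induction along the monomial order)
  set W : Submodule K (MvPolynomial (Fin m) K) := idealDegree I 1 with hW
  have hdeg_of_mem : ∀ {f : MvPolynomial (Fin m) K}, f.IsHomogeneous 1 → ∀ s ∈ f.support, ∑ i, s i = 1 := by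
    intro f hf s hs
    have h1 := hf (mem_support_iff.mp hs)
    have h2 : Finsupp.degree s = Finsupp.weight (fun _ => 1) s := DFunLike.congr_fun Finsupp.degree_eq_weight_one s
    rw [← Finsupp.degree_eq_sum, h2]
    exact h1
  have hXsup : ∀ y : Fin m, (X y : MvPolynomial (Fin m) K) ∈ W ⊔ R := by
    suffices h : ∀ (a : mo.syn) (y : Fin m), mo.toSyn (Finsupp.single y 1) = a →
        (X y : MvPolynomial (Fin m) K) ∈ W ⊔ R from fun y => h _ y rfl
    intro a
    refine WellFoundedLT.induction (motive := fun a => ∀ y : Fin m, mo.toSyn (Finsupp.single y 1) = a →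
      (X y : MvPolynomial (Fin m) K) ∈ W ⊔ R) a (fun a ih => ?_)
    intro y hya
    by_cases hyV : y ∈ V
    · exact Submodule.mem_sup_right (hXR y hyV)
    · have hyLE : Finsupp.single y 1 ∈ LE := by
        by_contra h
        exact hyV ((hmemV y).mpr h)
      obtain ⟨g₁, hg₁I, hg₁0, hg₁deg⟩ := hyLE
      have hdeg1 : (mo.degree g₁).degree = 1 := by rw [hg₁deg, Finsupp.degree_single]
      obtain ⟨hL0, hLdeg⟩ := degree_homogeneousComponent_eq mo hg₁0 hdeg1
      rw [hg₁deg] at hLdeg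
      set L := homogeneousComponent 1 g₁ with hL
      have hLW : L ∈ W := ⟨hI g₁ hg₁I 1, homogeneousComponent_isHomogeneous 1 g₁⟩
      have hLhom : L.IsHomogeneous 1 := homogeneousComponent_isHomogeneous 1 g₁
      -- the other monomials of `L` are smaller variables: in `W ⊔ R` by induction
      have hrest : ∀ s ∈ L.support, s ≠ Finsupp.single y 1 →
          (monomial s (coeff s L) : MvPolynomial (Fin m) K) ∈ W ⊔ R := by
        intro s hs hsne
        obtain ⟨y', rfl⟩ := exists_eq_single_of_sum_eq_one (hdeg_of_mem hLhom s hs)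
        have hlt : mo.toSyn (Finsupp.single y' 1) < a := by
          rw [← hya]
          refine lt_of_le_of_ne ?_ (fun h => hsne (mo.toSyn.injective h))
          rw [← hLdeg]
          exact mo.le_degree hs
        rw [monomial_single_eq_smul_X]
        exact Submodule.smul_mem _ _ (ih _ hlt y' rfl)
      have hymem : Finsupp.single y 1 ∈ L.support := by rw [← hLdeg]; exact mo.degree_mem_support hL0
      have hsum := L.as_sum
      rw [← Finset.add_sum_erase _ _ hymem] at hsum
      have hrest_mem : (∑ s ∈ L.support.erase (Finsupp.single y 1), monomial s (coeff s L)) ∈ W ⊔ R :=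
        Submodule.sum_mem _ fun s hs => hrest s (Finset.mem_of_mem_erase hs) (Finset.ne_of_mem_erase hs)
      have hc : coeff (Finsupp.single y 1) L ≠ 0 := mem_support_iff.mp hymem
      have hcX : coeff (Finsupp.single y 1) L • (X y : MvPolynomial (Fin m) K) ∈ W ⊔ R := by
        have h : (monomial (Finsupp.single y 1) (coeff (Finsupp.single y 1) L) : MvPolynomial (Fin m) K) =
            L - ∑ s ∈ L.support.erase (Finsupp.single y 1), monomial s (coeff s L) := by
          rw [eq_sub_iff_add_eq]; exact hsum.symm
        rw [← monomial_single_eq_smul_X, h]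
        exact Submodule.sub_mem _ (Submodule.mem_sup_left hLW) hrest_mem
      have h := Submodule.smul_mem _ (coeff (Finsupp.single y 1) L)⁻¹ hcX
      rwa [smul_smul, inv_mul_cancel₀ hc, one_smul] at h
  -- the decompositions `X y = L'_y + r_y` (`r_y = X y` for a standard variable)
  have hdec : ∀ y : Fin m, ∃ Lr : MvPolynomial (Fin m) K × MvPolynomial (Fin m) K,
      Lr.1 ∈ W ∧ Lr.2 ∈ R ∧ Lr.1 + Lr.2 = X y := by
    intro y
    obtain ⟨a, ha, b, hb, hab⟩ := Submodule.mem_sup.mp (hXsup y)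
    exact ⟨(a, b), ha, hb, hab⟩
  choose Lr hLrW hLrR hLrX using hdec
  set rf : Fin m → MvPolynomial (Fin m) K := fun y => if y ∈ V then X y else (Lr y).2 with hrf
  have hrfV : ∀ y ∈ V, rf y = X y := fun y hy => by simp only [hrf, if_pos hy]
  have hrfN : ∀ y, y ∉ V → rf y = (Lr y).2 := fun y hy => by simp only [hrf, if_neg hy]
  have hrfR : ∀ y, rf y ∈ R := fun y => by
    by_cases hy : y ∈ V
    · rw [hrfV y hy]; exact hXR y hy
    · rw [hrfN y hy]; exact hLrR y
  have hrfI : ∀ y, rf y - X y ∈ I := fun y => by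
    by_cases hy : y ∈ V
    · rw [hrfV y hy, sub_self]; exact I.zero_mem
    · rw [hrfN y hy, show (Lr y).2 - X y = -(Lr y).1 by rw [← hLrX y]; ring]
      exact I.neg_mem (hLrW y).1
  -- the substitution `φ = aeval rf`: `φ ≡ id (mod Ann ℓ)`, `φ(S_1) ⊆ R`, so `φ` kills `(Ann ℓ)_1`
  have hφI : ∀ f, aeval rf f - f ∈ I := by
    intro f
    have hq : (Ideal.Quotient.mkₐ K I).comp (aeval rf) = Ideal.Quotient.mkₐ K I := by
      refine algHom_ext fun y => ?_
      rw [AlgHom.comp_apply, aeval_X, Ideal.Quotient.mkₐ_eq_mk, Ideal.Quotient.eq]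
      exact hrfI y
    have h := AlgHom.congr_fun hq f
    rw [AlgHom.comp_apply, Ideal.Quotient.mkₐ_eq_mk] at h
    exact Ideal.Quotient.eq.mp h
  have hφR : ∀ f : MvPolynomial (Fin m) K, f.IsHomogeneous 1 → aeval rf f ∈ R := by
    intro f hf
    rw [f.as_sum, map_sum]
    refine Submodule.sum_mem _ fun s hs => ?_
    obtain ⟨y, rfl⟩ := exists_eq_single_of_sum_eq_one (hdeg_of_mem hf s hs)
    rw [monomial_single_eq_smul_X, map_smul, aeval_X]
    exact Submodule.smul_mem _ _ (hrfR y)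
  have hφW : ∀ f ∈ W, aeval rf f = 0 := by
    intro f hf
    apply hIR
    · have h := I.add_mem hf.1 (hφI f)
      rwa [add_sub_cancel] at h
    · exact hφR f hf.2
  have hspan : Ideal.span (W : Set (MvPolynomial (Fin m) K)) ≤
      RingHom.ker (aeval rf : MvPolynomial (Fin m) K →ₐ[K] MvPolynomial (Fin m) K) := by
    rw [Ideal.span_le]
    intro f hf
    exact hφW f hf
  -- `φ` does not raise leading monomials: `deg r_y ≼ x_y`
  have hdeg_rf : ∀ y, mo.toSyn (mo.degree (rf y)) ≤ mo.toSyn (Finsupp.single y 1) := by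
    intro y
    by_cases hyV : y ∈ V
    · rw [hrfV y hyV]; exact mo.degree_X_le_single
    rw [hrfN y hyV]
    -- `L'_y = X y − r_y ∈ Ann ℓ` is non-zero with leading term `x_y`, and `supp r_y ⊆ supp L'_y`
    have hsuppr : ∀ s ∈ (Lr y).2.support, s ≠ Finsupp.single y 1 := by
      intro s hs hsy
      obtain ⟨v, hv, hvs⟩ := (hmemR _).mp (hLrR y) s hs
      rw [hsy] at hvs
      have : y = v := Finsupp.single_left_injective one_ne_zero hvs
      exact hyV (this ▸ hv)
    have hcoeff : ∀ s, s ≠ Finsupp.single y 1 → coeff s (Lr y).1 = - coeff s (Lr y).2 := by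
      intro s hs
      have h := congr_arg (coeff s) (hLrX y)
      rw [coeff_add, coeff_X, if_neg (Ne.symm hs)] at h
      linear_combination h
    have hsub : (Lr y).2.support ⊆ (Lr y).1.support := by
      intro s hs
      have hs' := hsuppr s hs
      rw [MvPolynomial.mem_support_iff] at hs ⊢
      rw [hcoeff s hs']
      exact neg_ne_zero.mpr hs
    have hL10 : (Lr y).1 ≠ 0 := by
      intro h0
      have hX : (X y : MvPolynomial (Fin m) K) = (Lr y).2 := by rw [← hLrX y, h0, zero_add]
      have hs : Finsupp.single y 1 ∈ (Lr y).2.support := by rw [← hX, support_X]; exact Finset.mem_singleton_self _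
      exact hsuppr _ hs rfl
    have hL1deg : mo.degree (Lr y).1 = Finsupp.single y 1 := by
      have hmem := mo.degree_mem_support hL10
      by_contra hne1
      -- then the leading exponent of `L'_y` is a standard variable — impossible for a member of `Ann ℓ`
      have hmem2 : mo.degree (Lr y).1 ∈ (Lr y).2.support := by
        rw [MvPolynomial.mem_support_iff] at hmem ⊢
        rw [hcoeff _ hne1] at hmem
        exact neg_ne_zero.mp hmem
      obtain ⟨v, hv, hvs⟩ := (hmemR _).mp (hLrR y) _ hmem2
      exact (hmemV v).mp hv ⟨(Lr y).1, (hLrW y).1, hL10, hvs⟩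
    rw [← hL1deg]
    exact mo.degree_le_degree_of_support_subset hsub
  have hdegφ : ∀ s : Fin m →₀ ℕ, mo.toSyn (mo.degree (aeval rf (monomial s (1 : K)))) ≤ mo.toSyn s := by
    intro s
    rw [aeval_monomial, map_one, one_mul, Finsupp.prod]
    refine le_trans mo.degree_prod_le ?_
    rw [map_sum]
    calc ∑ y ∈ s.support, mo.toSyn (mo.degree (rf y ^ s y))
        ≤ ∑ y ∈ s.support, mo.toSyn (s y • Finsupp.single y 1) :=
          Finset.sum_le_sum fun y _ => le_trans (mo.degree_pow_le _) (by
            rw [map_nsmul, map_nsmul]; exact nsmul_le_nsmul_right (hdeg_rf y) _)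
      _ = mo.toSyn s := by
          rw [← map_sum]
          congr 1
          conv_rhs => rw [← Finsupp.sum_single s]
          rw [Finsupp.sum]
          exact Finset.sum_congr rfl fun y _ => Finsupp.smul_single_one y (s y)
  -- `coeff_μ φ(C) = LC(C) ≠ 0`
  have hφμ : aeval rf (monomial μ (1 : K)) = monomial μ 1 := by
    rw [aeval_monomial, map_one, one_mul, monomial_eq, C_1, one_mul]
    refine Finsupp.prod_congr fun y hy => ?_
    rw [hrfV y (hμV y (Finsupp.mem_support_iff.mp hy))]
  have hcoeffC : coeff μ (aeval rf C) = coeff μ C := by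
    conv_lhs => rw [C.as_sum, map_sum, coeff_sum]
    rw [Finset.sum_eq_single μ]
    · rw [show monomial μ (coeff μ C) = coeff μ C • monomial μ (1 : K) by rw [smul_monomial, smul_eq_mul, mul_one],
        map_smul, hφμ, coeff_smul, coeff_monomial, if_pos rfl, smul_eq_mul, mul_one]
    · intro s hs hsμ
      have hlt : mo.toSyn s < mo.toSyn μ :=
        lt_of_le_of_ne (by rw [← hCdeg]; exact mo.le_degree hs) (fun h => hsμ (mo.toSyn.injective h))
      rw [show monomial s (coeff s C) = coeff s C • monomial s (1 : K) by rw [smul_monomial, smul_eq_mul, mul_one],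
        map_smul, coeff_smul, mo.coeff_eq_zero_of_lt (lt_of_le_of_lt (hdegφ s) hlt), smul_zero]
    · intro hμ
      rw [notMem_support_iff.mp hμ, monomial_zero, map_zero, coeff_zero]
  have hLC : coeff μ C ≠ 0 := by rw [← hCdeg]; exact mo.coeff_degree_ne_zero_iff.mpr hC0
  intro hCmem
  have h0 : aeval rf C = 0 := hspan hCmem
  rw [← hcoeffC, h0, coeff_zero] at hLC
  exact hLC rfl

end Functional

/-! ## Period-matrix and census forms -/

section PeriodMatrix

open MvPolynomial Module Movasati2016 Literature.RingTheory.MvPolynomial Literature.AlgebraicGeometry.Kloosterman2025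

attribute [local instance] MvPolynomial.gradedAlgebra

variable {K : Type*} [Field K] {m d : ℕ}

/-- **Equality clause for Movasati's period matrix** (`m` variables, `d ≥ 4`, `k ≥ 2`, `d + N = (k+1)(d−2)`): if an
admissible period vector `p` (zero on the box-leaving exponents, non-zero somewhere on `I_{d+N}`) has
`rank [p_{i+j}]_{I_N × I_d}` EQUAL to the `(1,…,1,2)` value `ciHilbert(2, d−2, (d−1)^k)(d)`, then the Gorenstein ideal
`J = Ann ℓ_p` of its period functional (tree `vectorFunctional`; `rank [p_{i+j}] = HF_J(d)`, [Movasati2016Periods] Thm. 6 in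
algebraic form) has `dim J_1 = m − (k+2)` and contains a quadric outside the ideal of its linear forms — `I(Z) ⊆ J` for
the complete intersection `Z = V(J_1, C)` of type `(1,…,1,2)`. [cite: Villaflorloyola2021, Theorem 1.3]
[cite: Movasati2016Periods, Definition 1, Theorem 6] -/
theorem exists_quadric_of_rank_periodMatrix_eq_secondGap {k N : ℕ} (hk : 2 ≤ k) (hd : 4 ≤ d)
    (hN : d + N = (k + 1) * (d - 2)) (p : (Fin m → ℕ) → K)
    (hbox : ∀ i : Fin m → ℕ, (∃ e, d - 1 ≤ i e) → p i = 0) (hne : ∃ i ∈ indexSet m d (d + N), p i ≠ 0)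
    (hrank : (periodMatrix m d N d p).rank = ciHilbert (2 :: (d - 2) :: List.replicate k (d - 1)) d) :
    finrank K (idealDegree (annIdeal (vectorFunctional m (d + N) p)) 1) + (k + 2) = m ∧
      ∃ C : MvPolynomial (Fin m) K, C ∈ annIdeal (vectorFunctional m (d + N) p) ∧ C.IsHomogeneous 2 ∧
        C ∉ Ideal.span ((idealDegree (annIdeal (vectorFunctional m (d + N) p)) 1 :
          Submodule K (MvPolynomial (Fin m) K)) : Set (MvPolynomial (Fin m) K)) := by
  classical
  set ℓ := vectorFunctional m (d + N) p with hℓdef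
  have hbox' : ∀ s : Fin m →₀ ℕ, (∃ e, d - 1 ≤ s e) → ℓ (monomial s 1) = 0 := by
    intro s hs
    rw [hℓdef, vectorFunctional_monomial]
    split_ifs
    · exact hbox _ hs
    · rfl
  have hℓ : ∀ q, ℓ (homogeneousComponent (d + N) q) = ℓ q := vectorFunctional_homogeneousComponent _ p
  have hne' : ℓ ≠ 0 := by
    obtain ⟨i, hi, hpi⟩ := hne
    intro h0
    apply hpi
    have h1 := periodVector_vectorFunctional (d + N) p (mem_indexSet.mp hi).2
    rw [← h1, periodVector, ← hℓdef, h0, LinearMap.zero_apply]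
  rw [← periodMatrix_vectorFunctional rfl p, ← hℓdef, rank_periodMatrix_eq_hilbert ℓ hbox' hℓ rfl] at hrank
  exact exists_quadric_not_mem_span_linearForms_of_hilbert_eq_secondGap hk hd ℓ hbox' hℓ hN hne' hrank

/-- Degree bookkeeping: `d + ((n/2)d − n − 2) = (n/2+1)(d−2)` for `n = 2k`, `n + 2 ≤ k·d`. [folklore] -/
private theorem deg_add_rowDeg₂ {n k : ℕ} (hk : n = 2 * k) (hN : n + 2 ≤ k * d) :
    d + (k * d - n - 2) = (k + 1) * (d - 2) := by
  subst hk
  obtain ⟨d', rfl⟩ : ∃ d', d = d' + 2 := ⟨d - 2, by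
    by_contra h
    have : k * d ≤ k * 1 := Nat.mul_le_mul_left k (by omega)
    omega⟩
  have e1 : (k + 1) * (d' + 2 - 2) = k * d' + d' := by rw [Nat.add_sub_cancel]; ring
  have e2 : k * (d' + 2) = k * d' + 2 * k := by ring
  rw [e2] at hN
  rw [e1, e2]
  omega

/-- **Census form (Fermat `n`-fold, `n ≥ 4` even, `d ≥ 4`).** For every admissible period vector `p` whose matrix
`[p_{i+j}]` ([Movasati2016Periods] Def. 1: rows `I_{(n/2)d−n−2}`, columns `I_d`) has rank EQUAL to the `(1,…,1,2)`
complete-intersection codimension `ciLocusCodim (1^{n/2}, 2) d = C(n/2+d,d) + C(n/2+d−1,d−1) − (3n²/8 + 9n/4 + 2)`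
(`(4,4)`: `8`; `(4,5)`: `19`; `(4,6)`: `32`; `(6,4)`: `26`), the ideal `J = Ann ℓ_p` (`= J^{F,δ}` for the class `δ`
with periods `p`) has exactly `n/2` independent linear forms and a quadric `C ∈ J` not in the ideal they generate:
`I(Z) ⊆ J^{F,δ}` for the complete intersection `Z = V(J_1, C) ⊆ ℙ^{n+1}` of type `(1,…,1,2)`.
[cite: Villaflorloyola2021, Theorem 1.3] [cite: Movasati2016Periods, Definition 1, Theorem 6] -/
theorem exists_quadric_of_rank_periodMatrix_eq_ciLocusCodim {n : ℕ} (hn : Even n) (hn4 : 4 ≤ n) (hd : 4 ≤ d)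
    (p : (Fin (n + 2) → ℕ) → K) (hbox : ∀ i : Fin (n + 2) → ℕ, (∃ e, d - 1 ≤ i e) → p i = 0)
    (hne : ∃ i ∈ indexSet (n + 2) d ((n / 2 + 1) * (d - 2)), p i ≠ 0)
    (hrank : (periodMatrix (n + 2) d (n / 2 * d - n - 2) d p).rank =
      ciLocusCodim (List.replicate (n / 2) 1 ++ [2]) d) :
    finrank K (idealDegree (annIdeal (vectorFunctional (n + 2) ((n / 2 + 1) * (d - 2)) p)) 1) = n / 2 ∧
      ∃ C : MvPolynomial (Fin (n + 2)) K, C ∈ annIdeal (vectorFunctional (n + 2) ((n / 2 + 1) * (d - 2)) p) ∧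
        C.IsHomogeneous 2 ∧
        C ∉ Ideal.span ((idealDegree (annIdeal (vectorFunctional (n + 2) ((n / 2 + 1) * (d - 2)) p)) 1 :
          Submodule K (MvPolynomial (Fin (n + 2)) K)) : Set (MvPolynomial (Fin (n + 2)) K)) := by
  have hk : n = 2 * (n / 2) := by obtain ⟨r, hr⟩ := hn; omega
  have hN : n + 2 ≤ n / 2 * d := by
    have : n / 2 * 4 ≤ n / 2 * d := Nat.mul_le_mul_left _ hd
    omega
  have hdeg := deg_add_rowDeg₂ hk hN
  rw [← ciHilbert_preFinal_eq_ciLocusCodim (n / 2) d (by omega)] at hrank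
  rw [← hdeg] at hne ⊢
  obtain ⟨hfin, hC⟩ := exists_quadric_of_rank_periodMatrix_eq_secondGap (m := n + 2) (k := n / 2)
    (N := n / 2 * d - n - 2) (by omega) hd hdeg p hbox hne hrank
  exact ⟨by omega, hC⟩

/-- **Quartic fourfolds `(4,4)`, the rank-`8` classes**: a period vector with `rank [p_{i+j}] = 8` (the second value;
`6` is the linear `ℙ²`) has `dim (J^{F,δ})_1 = 2` and a quadric in `J^{F,δ}` outside `((J^{F,δ})_1)` — the ideal of
a quadric surface `Z = V(L_0, L_2, C) ⊂ ℙ⁵` lies in `J^{F,δ}` (Movasati: "`Σ_{1,1,2}` has codimension `8`").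
[cite: Villaflorloyola2021, Theorem 1.3] [cite: Movasati2016Periods, §6] -/
theorem exists_quadric_quarticFourfold_of_rank_eq_eight (p : (Fin 6 → ℕ) → K)
    (hbox : ∀ i : Fin 6 → ℕ, (∃ e, 3 ≤ i e) → p i = 0) (hne : ∃ i ∈ indexSet 6 4 6, p i ≠ 0)
    (hrank : (periodMatrix 6 4 2 4 p).rank = 8) :
    finrank K (idealDegree (annIdeal (vectorFunctional 6 6 p)) 1) = 2 ∧
      ∃ C : MvPolynomial (Fin 6) K, C ∈ annIdeal (vectorFunctional 6 6 p) ∧ C.IsHomogeneous 2 ∧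
        C ∉ Ideal.span ((idealDegree (annIdeal (vectorFunctional 6 6 p)) 1 :
          Submodule K (MvPolynomial (Fin 6) K)) : Set (MvPolynomial (Fin 6) K)) := by
  have hv : ciHilbert (2 :: (4 - 2) :: List.replicate 2 (4 - 1)) 4 = 8 := by decide
  rw [← hv] at hrank
  have h := exists_quadric_of_rank_periodMatrix_eq_secondGap (m := 6) (k := 2) (N := 2) (d := 4) le_rfl le_rfl
    (by norm_num) p hbox hne hrank
  rw [show (4 : ℕ) + 2 = 6 from rfl] at h
  exact ⟨by omega, h.2⟩

/-- **Quintic fourfolds `(4,5)`, the rank-`19` classes**: `dim (J^{F,δ})_1 = 2` and a quadric of `J^{F,δ}` outside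
`((J^{F,δ})_1)`. [cite: Villaflorloyola2021, Theorem 1.3] -/
theorem exists_quadric_quinticFourfold_of_rank_eq_nineteen (p : (Fin 6 → ℕ) → K)
    (hbox : ∀ i : Fin 6 → ℕ, (∃ e, 4 ≤ i e) → p i = 0) (hne : ∃ i ∈ indexSet 6 5 9, p i ≠ 0)
    (hrank : (periodMatrix 6 5 4 5 p).rank = 19) :
    finrank K (idealDegree (annIdeal (vectorFunctional 6 9 p)) 1) = 2 ∧
      ∃ C : MvPolynomial (Fin 6) K, C ∈ annIdeal (vectorFunctional 6 9 p) ∧ C.IsHomogeneous 2 ∧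
        C ∉ Ideal.span ((idealDegree (annIdeal (vectorFunctional 6 9 p)) 1 :
          Submodule K (MvPolynomial (Fin 6) K)) : Set (MvPolynomial (Fin 6) K)) := by
  have hv : ciHilbert (2 :: (5 - 2) :: List.replicate 2 (5 - 1)) 5 = 19 := by decide
  rw [← hv] at hrank
  have h := exists_quadric_of_rank_periodMatrix_eq_secondGap (m := 6) (k := 2) (N := 4) (d := 5) le_rfl (by norm_num)
    (by norm_num) p hbox hne hrank
  rw [show (5 : ℕ) + 4 = 9 from rfl] at h
  exact ⟨by omega, h.2⟩

/-- **Quartic sixfolds `(6,4)`, the rank-`26` classes**: `dim (J^{F,δ})_1 = 3` and a quadric of `J^{F,δ}` outside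
`((J^{F,δ})_1)` (`Z = V(L_0, L_2, L_4, C) ⊂ ℙ⁷` of type `(1,1,1,2)`). [cite: Villaflorloyola2021, Theorem 1.3] -/
theorem exists_quadric_quarticSixfold_of_rank_eq_twentySix (p : (Fin 8 → ℕ) → K)
    (hbox : ∀ i : Fin 8 → ℕ, (∃ e, 3 ≤ i e) → p i = 0) (hne : ∃ i ∈ indexSet 8 4 8, p i ≠ 0)
    (hrank : (periodMatrix 8 4 4 4 p).rank = 26) :
    finrank K (idealDegree (annIdeal (vectorFunctional 8 8 p)) 1) = 3 ∧
      ∃ C : MvPolynomial (Fin 8) K, C ∈ annIdeal (vectorFunctional 8 8 p) ∧ C.IsHomogeneous 2 ∧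
        C ∉ Ideal.span ((idealDegree (annIdeal (vectorFunctional 8 8 p)) 1 :
          Submodule K (MvPolynomial (Fin 8) K)) : Set (MvPolynomial (Fin 8) K)) := by
  have hv : ciHilbert (2 :: (4 - 2) :: List.replicate 3 (4 - 1)) 4 = 26 := by decide
  rw [← hv] at hrank
  have h := exists_quadric_of_rank_periodMatrix_eq_secondGap (m := 8) (k := 3) (N := 4) (d := 4) (by norm_num) le_rfl
    (by norm_num) p hbox hne hrank
  rw [show (4 : ℕ) + 4 = 8 from rfl] at h
  exact ⟨by omega, h.2⟩

/-- **Quartic eightfolds `(8,4)`, the rank-`61` classes**: `dim (J^{F,δ})_1 = 4` and a quadric of `J^{F,δ}` outside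
`((J^{F,δ})_1)` (`Z ⊂ ℙ⁹` of type `(1,1,1,1,2)`). [cite: Villaflorloyola2021, Theorem 1.3] -/
theorem exists_quadric_quarticEightfold_of_rank_eq_sixtyOne (p : (Fin 10 → ℕ) → K)
    (hbox : ∀ i : Fin 10 → ℕ, (∃ e, 3 ≤ i e) → p i = 0) (hne : ∃ i ∈ indexSet 10 4 10, p i ≠ 0)
    (hrank : (periodMatrix 10 4 6 4 p).rank = 61) :
    finrank K (idealDegree (annIdeal (vectorFunctional 10 10 p)) 1) = 4 ∧
      ∃ C : MvPolynomial (Fin 10) K, C ∈ annIdeal (vectorFunctional 10 10 p) ∧ C.IsHomogeneous 2 ∧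
        C ∉ Ideal.span ((idealDegree (annIdeal (vectorFunctional 10 10 p)) 1 :
          Submodule K (MvPolynomial (Fin 10) K)) : Set (MvPolynomial (Fin 10) K)) := by
  have hv : ciHilbert (2 :: (4 - 2) :: List.replicate 4 (4 - 1)) 4 = 61 := by decide
  rw [← hv] at hrank
  have h := exists_quadric_of_rank_periodMatrix_eq_secondGap (m := 10) (k := 4) (N := 6) (d := 4) (by norm_num) le_rfl
    (by norm_num) p hbox hne hrank
  rw [show (4 : ℕ) + 6 = 10 from rfl] at h
  exact ⟨by omega, h.2⟩

/-- **Every combination of linear cycles** attaining the second value: for `δ = Σ_k c_k [ℙ^{n/2}_{a_k,b_k}]` on the Fermat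
`n`-fold (`n ≥ 4` even, `d ≥ 4`, any `ζ`; period vector `p(δ)` = tree `MovasatiVillaflor2018.combPeriod`, non-zero on
`I_σ`) with `rank [p_{i+j}(δ)] = ciLocusCodim (1^{n/2}, 2) d`, the ideal `J^{F,δ} = Ann ℓ_{p(δ)}` has exactly `n/2`
independent linear forms and a quadric outside the ideal they generate (`I(Z) ⊆ J^{F,δ}`, `Z` a CI of type
`(1,…,1,2)`). [cite: Villaflorloyola2021, Theorem 1.3] [cite: MovasatiVillaflor2018, §5, Proposition 1] -/
theorem exists_quadric_comb_of_rank_periodMatrix_eq_ciLocusCodim {n : ℕ} (hn : Even n) (hn4 : 4 ≤ n) (hd : 4 ≤ d)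
    (ζ : K) (δ : List (K × (Fin (n + 2) → ℕ) × Equiv.Perm (Fin (n + 2))))
    (hne : ∃ i ∈ indexSet (n + 2) d ((n / 2 + 1) * (d - 2)), MovasatiVillaflor2018.combPeriod n d ζ δ i ≠ 0)
    (hrank : (periodMatrix (n + 2) d (n / 2 * d - n - 2) d (MovasatiVillaflor2018.combPeriod n d ζ δ)).rank =
      ciLocusCodim (List.replicate (n / 2) 1 ++ [2]) d) :
    finrank K (idealDegree (annIdeal
        (vectorFunctional (n + 2) ((n / 2 + 1) * (d - 2)) (MovasatiVillaflor2018.combPeriod n d ζ δ))) 1) = n / 2 ∧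
      ∃ C : MvPolynomial (Fin (n + 2)) K,
        C ∈ annIdeal (vectorFunctional (n + 2) ((n / 2 + 1) * (d - 2)) (MovasatiVillaflor2018.combPeriod n d ζ δ)) ∧
        C.IsHomogeneous 2 ∧
        C ∉ Ideal.span ((idealDegree (annIdeal
          (vectorFunctional (n + 2) ((n / 2 + 1) * (d - 2)) (MovasatiVillaflor2018.combPeriod n d ζ δ))) 1 :
            Submodule K (MvPolynomial (Fin (n + 2)) K)) : Set (MvPolynomial (Fin (n + 2)) K)) :=
  exists_quadric_of_rank_periodMatrix_eq_ciLocusCodim hn hn4 hd _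
    (fun _ hi => MovasatiVillaflor2018.combPeriod_eq_zero_of_le ζ hn (by omega) δ hi) hne hrank

end PeriodMatrix

end Literature.AlgebraicGeometry.Villaflor2022

end
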